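import Literature.NumberTheory.GaloisRepresentations.AdequateOfCoprimeOrder
import Literature.GroupTheory.SpecificGroups.PGL2SylowCharP
import HarnessLib

/-!
# Adequacy in degree two: the case `p = 2` of Guralnick–Herzig–Tiep 2017, Theorem 1.7, proved

Topic `NumberTheory/GaloisRepresentations`; a sibling of `AdequacyDegreeP.lean` (the named fact
`ght2017_adequate_or_index_p_or_psl29` = GHT 2017 Thm 1.7, its reduction to the primitive
algebraically closed case `ght2017_adequate_or_index_p_or_psl29_of_primitive`, and GHT Prop. 6.6)
and of `AdequateOfCoprimeOrder.lean`.  Theorems only (plus small definitions: the unipotent matrices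
`u_a`, the subgroups of upper unipotent / upper triangular elements, the ratio character, three
linear forms on `ad/Z`); NO named fact, no `sorry`.

Source: R. M. Guralnick, F. Herzig, P. H. Tiep, *Adequate subgroups and indecomposable modules*,
J. Eur. Math. Soc. 19 (2017) 1231–1291 = arXiv:1405.0043, Theorem 1.7 / Theorem 6.15 in the case
`p = 2` (`dim V = p = 2`): "precisely one of the following holds: (a) `(G, V)` is adequate; (b) `G`
contains a normal abelian subgroup of index `p`; (c) `p = 3` and …".  For `p = 2` the printed
proof of Thm 6.15 (p. 24) runs: `G` imprimitive ⇒ (b) or adequate by Prop. 6.6; `G` primitive ⇒ by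
Prop. 6.5 / Thm 2.2 (the classification of finite simple groups) `H = SL₂(2^a)`, adequate by
Cor. 9.4 (b) ([AJL] `Ext` computations).

## What is proved here, and how (a classification-free replacement of the printed argument)

Main results (all PROVED):

* `DegreeTwoAdequacy.isExtendedAdequate_range_or_exists_lines` — **the dichotomy**: `K`
  algebraically closed of characteristic `2`, `G` finite, `τ : G → GL₂(K)` faithful irreducible ⇒
  `τ(G)` is adequate in the extended sense (`Subgroup.IsExtendedAdequate`), OR `τ(G)` permutes the
  two lines of a basis through `θ` with `ker θ` not central (the imprimitive case).
* `ght2017_adequate_or_index_two` — **Theorem 1.7 for `p = 2`** over ANY field of characteristic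
  `2`: faithful absolutely irreducible `σ : G → GL₂(k)` ⇒ `σ(G)` adequate or `G` has an abelian
  normal subgroup of index `2` (descent by `Subgroup.IsExtendedAdequate.of_map`).
* `ght2017_adequate_or_index_p_or_psl29_of_primitive_odd` — the sharpened reduction of the named
  fact: the classification-dependent hypothesis of
  `ght2017_adequate_or_index_p_or_psl29_of_primitive` is now needed for ODD `p` only.
* `isExtendedAdequate_range_of_conjGL` — adequacy of the image is invariant under conjugation of
  the representation (all `n`, all fields).

Architecture of the proof of the dichotomy (namespace `DegreeTwoAdequacy`; `char K = 2`):
1. Matrix facts: `2`-elements of `GL₂(K)` are involutions `u` with `(u-1)² = 0` (from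
   `PGL2SylowCharP`), `tr u = 0`, an upper triangular involution is a `u_a = (1 a; 0 1)`; an element
   of finite order with `tr ≠ 0` and `(·)₁₀ ≠ 0` has ODD order (a power of order `2` would lie in
   `K·1 + K·g` and be scalar, `odd_orderOf_of_trace_ne_zero`); two involutions whose product has
   odd order are conjugate (`exists_conj_eq_of_odd_orderOf`, the dihedral group of twice odd order).
2. `|G|` odd ⇒ adequate (`isExtendedAdequate_range_of_not_dvd_card`).  Otherwise an involution
   fixes a vector, moved to `e₀` by conjugation; then `U = {g : τ g = u_a}` is a Sylow `2`-subgroup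
   (`unipSylow`), its normaliser is upper triangular and acts on the parameters `a` through the
   ratio `n₀₀/n₁₁`; irreducibility gives an involution `x` off the Borel, all `u_a ≠ 1` are conjugate
   to `x` (step 1), hence — Burnside's fusion lemma for the abelian Sylow subgroup `U` (Mathlib
   `Sylow.conj_eq_normalizer_conj_of_mem`) — conjugate under the normaliser: the ratios act
   TRANSITIVELY on the non-zero parameters, and a generator `d` of the (cyclic) ratio group gives
   `a = ratio(d)^j a₀` (`exists_forall_eq_ratio_pow_mul`).
3. If `u_{a₀}` is the only non-trivial element of `U` (`q = 2`): `N(U) = C(U)`, Burnside's transfer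
   theorem (Mathlib `MonoidHom.ker_transferSylow_isComplement'`) gives `M ⊴ G` of odd order and
   index `2` (`exists_normal_odd_index_two`); averaging `E₀₀` over `M` produces a non-scalar matrix
   (trace `|M| ≠ 0`) commuting with `τ(M)`, whence an `M`-stable line; odd-order elements with a
   repeated eigenvalue are scalar (`coe_eq_smul_one_of_odd`), so `τ(M)` is abelian and diagonal in
   a basis `(v₀, v₁)`, and `G` permutes the two eigenlines of a non-scalar `τ(m₀)`, which is not
   central (`exists_lines_of_normal_odd`) — the imprimitive alternative.
4. Otherwise (`q ≥ 4`) conjugate further so that `τ d` is diagonal (`isExtendedAdequate_range_of_upper`)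
   and prove the three clauses directly (`isExtendedAdequate_range_of_normalForm`):
   (i) `Hom(G, K) = 0`: an additive character is conjugation invariant, so it vanishes on
   `(d g d⁻¹) g` for `g ∈ U`, and `g ↦ (d g d⁻¹) g` is onto `U` (`ratio d ≠ 1`); involutions are
   conjugate into `U`, and `φ(h) = m⁻¹ φ(h^m)` with `h^m` a `2`-element;
   (iii) the elements `u_a τ(x)` (`a ≠ 0`) have odd order, and together with `1` and conjugation by
   `u_{a₀}` their span contains the four matrix units;
   (ii) `H¹(G, ad/Z) = 0`: restriction to `U ⋊ ⟨d⟩` (odd index, it contains the Sylow subgroup `U`)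
   reflects coboundaries (the tree's coset averaging `MonomialAdequacy.exists_eq_sub_of_subgroup`),
   a cocycle is a coboundary on `⟨d⟩` (odd order), and a cocycle vanishing on `⟨d⟩` is, in the
   coordinates `(M₀₀ - M₁₁, M₀₁, M₁₀)` of `ad/Z`, forced to be the coboundary of a multiple of
   `E₀₀` on `U` (`exists_eq_sub_sup_zpowers`: the doubling map kills the first coordinate,
   `f(g²) = f(1) = 0` the third, and transitivity of `⟨ratio d⟩` pins the second).
This replaces GHT's appeal to Prop. 6.5 (ii) / Thm 2.2 (Dickson, CFSG) and to Cor. 9.4 (b) ([AJL])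
for `p = 2`; no identification of `τ(G)` with `SL₂(2^a)` is needed.

## References

* [GuralnickHerzigTiep2017] Guralnick–Herzig–Tiep, JEMS 19 (2017) = arXiv:1405.0043, Thm 1.7,
  Thm 6.15 (proof, p. 24), Prop. 6.5, Prop. 6.6, Cor. 9.4 (b).
* [Thorne2017TwoAdic] J. Thorne, Math. Z. 285 (2017), Def. 2.20 (the notion of adequacy).
-/

open scoped MatrixGroups Matrix

namespace Literature.NumberTheory.GaloisRepresentations

namespace DegreeTwoAdequacy

variable {K : Type*} [Field K]

local notation "M₂" => Matrix (Fin 2) (Fin 2) K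

/-! ### Unipotent upper triangular matrices -/

/-- The unipotent upper triangular matrix `u_a = (1 a; 0 1)` as an element of `GL₂(K)`.
[folklore] -/
def unipotentGL (a : K) : GL (Fin 2) K :=
  ⟨!![1, a; 0, 1], !![1, -a; 0, 1],
    by
      ext i j
      fin_cases i <;> fin_cases j <;> simp [Matrix.mul_apply, Fin.sum_univ_two],
    by
      ext i j
      fin_cases i <;> fin_cases j <;> simp [Matrix.mul_apply, Fin.sum_univ_two]⟩

/-- The matrix of `u_a` is `(1 a; 0 1)`. [folklore] -/
@[simp] theorem coe_unipotentGL (a : K) :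
    ((unipotentGL a : GL (Fin 2) K) : M₂) = !![1, a; 0, 1] := rfl

/-- `u_a u_b = u_{a+b}`: `a ↦ u_a` is additive. [folklore] -/
theorem unipotentGL_mul (a b : K) : unipotentGL a * unipotentGL b = unipotentGL (a + b) := by
  apply Units.ext
  rw [Units.val_mul, coe_unipotentGL, coe_unipotentGL, coe_unipotentGL]
  ext i j
  fin_cases i <;> fin_cases j <;> simp [Matrix.mul_apply, Fin.sum_univ_two, add_comm]

/-- `u_0 = 1`. [folklore] -/
theorem unipotentGL_zero : unipotentGL (0 : K) = 1 := by
  apply Units.ext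
  rw [coe_unipotentGL, Units.val_one]
  ext i j
  fin_cases i <;> fin_cases j <;> simp

/-- `a ↦ u_a` is injective. [folklore] -/
theorem unipotentGL_injective : Function.Injective (unipotentGL : K → GL (Fin 2) K) := by
  intro a b h
  have h' := congrArg (fun g : GL (Fin 2) K => (g : M₂) 0 1) h
  simpa using h'

/-- `u_a⁻¹ = u_{-a}`. [folklore] -/
theorem unipotentGL_inv (a : K) : (unipotentGL a)⁻¹ = unipotentGL (-a) := by
  rw [inv_eq_iff_mul_eq_one, unipotentGL_mul, add_neg_cancel, unipotentGL_zero]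

/-- In characteristic `2`, `u_a` is an involution: `u_a² = u_{2a} = 1`. [folklore] -/
theorem unipotentGL_mul_self [CharP K 2] (a : K) : unipotentGL a * unipotentGL a = 1 := by
  rw [unipotentGL_mul, CharTwo.add_self_eq_zero, unipotentGL_zero]

/-- `u_a (v₀, v₁) = (v₀ + a v₁, v₁)`. [folklore] -/
theorem unipotentGL_mulVec (a : K) (v : Fin 2 → K) :
    ((unipotentGL a : GL (Fin 2) K) : M₂) *ᵥ v = ![v 0 + a * v 1, v 1] := by
  rw [coe_unipotentGL]
  ext i
  fin_cases i <;> simp [Matrix.mulVec, dotProduct, Fin.sum_univ_two]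

/-! ### Elementary facts in characteristic two -/

/-- In characteristic `2`, `x² = 1 ⇒ x = 1` (`(x-1)² = x² - 1`). [folklore] -/
theorem eq_one_of_mul_self_eq_one [CharP K 2] {x : K} (h : x * x = 1) : x = 1 := by
  have h2 : (2 : K) = 0 := CharTwo.two_eq_zero
  have : (x - 1) * (x - 1) = 0 := by linear_combination h + (1 - x) * h2
  exact sub_eq_zero.1 (mul_self_eq_zero.1 this)

/-- An involution of `GL₂(K)`, `char K = 2`, satisfies `(g - 1)² = 0`. [folklore] -/
theorem sub_one_mul_self_eq_zero_of_mul_self_eq_one [CharP K 2] {g : GL (Fin 2) K}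
    (h : g * g = 1) : ((g : M₂) - 1) * ((g : M₂) - 1) = 0 :=
  Literature.GroupTheory.SpecificGroups.PGL2.sub_one_mul_self_eq_zero_of_pow_char_eq_one 2
    (by rw [pow_two, h])

/-- A `2`-element of `GL₂(K)`, `char K = 2`, is an involution: `g ^ 2 ^ n = 1 ⇒ g² = 1`.
[folklore] -/
theorem mul_self_eq_one_of_pow_two_pow_eq_one [CharP K 2] {g : GL (Fin 2) K} {n : ℕ}
    (h : g ^ 2 ^ n = 1) : g * g = 1 := by
  have h1 := Literature.GroupTheory.SpecificGroups.PGL2.sub_one_mul_self_eq_zero_of_pow_char_pow_eq_one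
    2 h
  have h2 := Literature.GroupTheory.SpecificGroups.PGL2.pow_char_eq_one_of_sub_one_mul_self_eq_zero
    2 h1
  rwa [pow_two] at h2

/-- The trace of an involution vanishes (`char K = 2`). [folklore] -/
theorem trace_eq_zero_of_mul_self_eq_one [CharP K 2] {g : GL (Fin 2) K} (h : g * g = 1) :
    (g : M₂).trace = 0 := by
  have hN := sub_one_mul_self_eq_zero_of_mul_self_eq_one h
  have htr : ((g : M₂) - 1).trace = 0 :=
    (Matrix.isNilpotent_trace_of_isNilpotent ⟨2, by rw [pow_two, hN]⟩).eq_zero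
  rw [Matrix.trace_sub, Matrix.trace_one, Fintype.card_fin] at htr
  have h2 : ((2 : ℕ) : K) = 0 := by rw [Nat.cast_ofNat]; exact CharTwo.two_eq_zero
  rwa [h2, sub_zero] at htr

/-- The determinant of an involution is `1` (`char K = 2`). [folklore] -/
theorem det_eq_one_of_mul_self_eq_one [CharP K 2] {g : GL (Fin 2) K} (h : g * g = 1) :
    (g : M₂).det = 1 := by
  apply eq_one_of_mul_self_eq_one
  rw [← Matrix.det_mul, ← Units.val_mul, h, Units.val_one, Matrix.det_one]

/-- An upper triangular involution is unipotent: `g = u_{g₀₁}` (`char K = 2`). [folklore] -/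
theorem eq_unipotentGL_of_mul_self_eq_one [CharP K 2] {g : GL (Fin 2) K} (h : g * g = 1)
    (h10 : (g : M₂) 1 0 = 0) : g = unipotentGL ((g : M₂) 0 1) := by
  have hsq := congrArg (fun x : GL (Fin 2) K => (x : M₂)) h
  simp only [Units.val_mul, Units.val_one] at hsq
  have e00 := congrFun (congrFun hsq 0) 0
  have e11 := congrFun (congrFun hsq 1) 1
  simp only [Matrix.mul_apply, Fin.sum_univ_two, Matrix.one_apply_eq, h10, mul_zero, add_zero,
    zero_mul, zero_add] at e00 e11
  have h00 : (g : M₂) 0 0 = 1 := eq_one_of_mul_self_eq_one e00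
  have h11 : (g : M₂) 1 1 = 1 := eq_one_of_mul_self_eq_one e11
  apply Units.ext
  rw [coe_unipotentGL]
  ext i j
  fin_cases i <;> fin_cases j <;> simp [h00, h10, h11]

/-- The fixed vectors of `u_a`, `a ≠ 0`, are the multiples of `e₀`. [folklore] -/
theorem unipotentGL_mulVec_eq_self_iff {a : K} (ha : a ≠ 0) (v : Fin 2 → K) :
    ((unipotentGL a : GL (Fin 2) K) : M₂) *ᵥ v = v ↔ v 1 = 0 := by
  rw [unipotentGL_mulVec]
  constructor
  · intro h
    have h0 := congrFun h 0
    simp only [Matrix.cons_val_zero] at h0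
    have : a * v 1 = 0 := by linear_combination h0
    exact (mul_eq_zero.1 this).resolve_left ha
  · intro h
    ext i
    fin_cases i <;> simp [h]

/-- Conjugating `u_a` by an upper triangular matrix multiplies `a` by the ratio of the diagonal
entries. [folklore] -/
theorem conj_unipotentGL_of_upper {n : GL (Fin 2) K} (h10 : (n : M₂) 1 0 = 0) (a : K) :
    n * unipotentGL a * n⁻¹ = unipotentGL ((n : M₂) 0 0 / (n : M₂) 1 1 * a) := by
  have hdet : (n : M₂).det ≠ 0 := GL2.det_ne_zero n
  rw [Matrix.det_fin_two, h10, mul_zero, sub_zero] at hdet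
  have h11 : (n : M₂) 1 1 ≠ 0 := right_ne_zero_of_mul hdet
  rw [mul_inv_eq_iff_eq_mul]
  apply Units.ext
  simp only [Units.val_mul, coe_unipotentGL]
  ext i j
  fin_cases i <;> fin_cases j <;> simp [Matrix.mul_apply, Fin.sum_univ_two, h10]
  · field_simp
    ring

/-- Trace of `u_a g`: `tr(u_a g) = tr g + a g₁₀`. [folklore] -/
theorem trace_unipotentGL_mul (a : K) (g : M₂) :
    (((unipotentGL a : GL (Fin 2) K) : M₂) * g).trace = g.trace + a * g 1 0 := by
  rw [coe_unipotentGL, Matrix.trace_fin_two, Matrix.trace_fin_two]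
  simp [Matrix.mul_apply, Fin.sum_univ_two]
  ring

/-! ### Odd order from the trace -/

/-- Powers of `g` lie in `K·1 + K·g` (Cayley–Hamilton). [folklore] -/
theorem exists_coe_pow_eq (g : GL (Fin 2) K) (n : ℕ) :
    ∃ c d : K, ((g ^ n : GL (Fin 2) K) : M₂) = c • (1 : M₂) + d • (g : M₂) := by
  induction n with
  | zero => exact ⟨1, 0, by simp⟩
  | succ n ih =>
    obtain ⟨c, d, hcd⟩ := ih
    refine ⟨-(d * (g : M₂).det), c + d * (g : M₂).trace, ?_⟩
    rw [pow_succ, Units.val_mul, hcd, add_mul, smul_mul_assoc, one_mul, smul_mul_assoc,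
      GL2.cayley_hamilton_two]
    module

/-- **A non-upper-triangular element of finite order with non-zero trace has odd order**
(`char K = 2`): otherwise a power `ι ≠ 1` would be an involution lying in `K·1 + K·g`, forcing
`ι` scalar and then `ι = 1`. [folklore] -/
theorem odd_orderOf_of_trace_ne_zero [CharP K 2] {g : GL (Fin 2) K} (hfin : IsOfFinOrder g)
    (htr : (g : M₂).trace ≠ 0) (h10 : (g : M₂) 1 0 ≠ 0) : Odd (orderOf g) := by
  by_contra hodd
  rw [Nat.not_odd_iff_even, even_iff_two_dvd] at hodd
  obtain ⟨m, hm⟩ := hodd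
  have hpos : 0 < orderOf g := hfin.orderOf_pos
  have hm0 : m ≠ 0 := by rintro rfl; rw [mul_zero] at hm; omega
  set ι : GL (Fin 2) K := g ^ m with hι
  have hι1 : ι ≠ 1 := pow_ne_one_of_lt_orderOf hm0 (by omega)
  have hιι : ι * ι = 1 := by rw [hι, ← pow_add, ← two_mul, ← hm, pow_orderOf_eq_one]
  obtain ⟨c, d, hcd⟩ := exists_coe_pow_eq g m
  rw [← hι] at hcd
  have h2 : (2 : K) = 0 := CharTwo.two_eq_zero
  -- entries of `ι`
  have e00 : (ι : M₂) 0 0 = c + d * (g : M₂) 0 0 := by rw [hcd]; simp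
  have e01 : (ι : M₂) 0 1 = d * (g : M₂) 0 1 := by rw [hcd]; simp
  have e10 : (ι : M₂) 1 0 = d * (g : M₂) 1 0 := by rw [hcd]; simp
  have e11 : (ι : M₂) 1 1 = c + d * (g : M₂) 1 1 := by rw [hcd]; simp
  have hsq := congrArg (fun x : GL (Fin 2) K => (x : M₂)) hιι
  simp only [Units.val_mul, Units.val_one] at hsq
  have s10 := congrFun (congrFun hsq 1) 0
  have s00 := congrFun (congrFun hsq 0) 0
  simp only [Matrix.mul_apply, Fin.sum_univ_two, Matrix.one_apply_eq, Matrix.one_apply_ne,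
    ne_eq, one_ne_zero, not_false_eq_true] at s10 s00
  rw [Matrix.trace_fin_two] at htr
  -- `(ι²)₁₀ = d² tr(g) g₁₀ = 0`
  have hd : d * d * (((g : M₂) 0 0 + (g : M₂) 1 1) * (g : M₂) 1 0) = 0 := by
    rw [e10, e00, e11] at s10
    linear_combination s10 - c * d * (g : M₂) 1 0 * h2
  have hd0 : d = 0 := by
    rcases mul_eq_zero.1 hd with h | h
    · exact mul_self_eq_zero.1 h
    · exact absurd h (mul_ne_zero htr h10)
  -- then `ι = c • 1` with `c² = 1`, so `ι = 1`
  have hc : c * c = 1 := by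
    rw [e00, e01, e10, hd0] at s00
    linear_combination s00
  have hc1 : c = 1 := eq_one_of_mul_self_eq_one hc
  apply hι1
  apply Units.ext
  rw [hcd, hd0, hc1, zero_smul, add_zero, one_smul, Units.val_one]

/-! ### Two involutions whose product has odd order are conjugate -/

/-- In any group: if `u² = g² = 1` and `u g` has odd order `2k + 1`, then `(ug)^k` conjugates `u`
to `g` (all involutions of a dihedral group of twice odd order are conjugate). [folklore] -/
theorem exists_conj_eq_of_odd_orderOf {G : Type*} [Group G] {u g : G} (hu : u * u = 1)
    (hg : g * g = 1) (hodd : Odd (orderOf (u * g))) : ∃ h : G, h * u * h⁻¹ = g := by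
  obtain ⟨k, hk⟩ := hodd
  set w := u * g with hw
  have hu' : u⁻¹ = u := inv_eq_of_mul_eq_one_right hu
  have hg' : g⁻¹ = g := inv_eq_of_mul_eq_one_right hg
  have hwinv : w⁻¹ = g * u := by rw [hw, mul_inv_rev, hu', hg']
  have hconj : u * w * u⁻¹ = w⁻¹ := by rw [hwinv, hw, hu', ← mul_assoc, hu, one_mul]
  have hconjk : u * w ^ k * u⁻¹ = (w ^ k)⁻¹ := by rw [← conj_pow, hconj, inv_pow]
  refine ⟨w ^ k, ?_⟩
  have h1 : u * (w ^ k)⁻¹ = w ^ k * u := by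
    have h := congrArg (·⁻¹) hconjk
    simp only [mul_inv_rev, inv_inv] at h
    calc u * (w ^ k)⁻¹ = u * ((w ^ k)⁻¹ * u⁻¹) * u := by group
      _ = w ^ k * u := by rw [h]
  have h2 : w ^ k * u * (w ^ k)⁻¹ = w ^ (2 * k) * u := by
    rw [mul_assoc, h1, ← mul_assoc, ← pow_add, two_mul]
  have h3 : w ^ (2 * k) = w⁻¹ := by
    rw [eq_inv_iff_mul_eq_one, ← pow_succ, ← hk, pow_orderOf_eq_one]
  rw [h2, h3, hwinv, mul_assoc, hu, mul_one]

/-! ### The Sylow `2`-subgroup of upper unipotent elements and its normaliser -/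

section Group

variable {G : Type*} [Group G] (τ : G →* GL (Fin 2) K)

/-- The elements of `G` mapping to upper unipotent matrices `u_a`. [folklore] -/
def unipSubgroup : Subgroup G where
  carrier := {g | ∃ a : K, τ g = unipotentGL a}
  one_mem' := ⟨0, by rw [map_one, unipotentGL_zero]⟩
  mul_mem' := by
    rintro x y ⟨a, ha⟩ ⟨b, hb⟩
    exact ⟨a + b, by rw [map_mul, ha, hb, unipotentGL_mul]⟩
  inv_mem' := by
    rintro x ⟨a, ha⟩
    exact ⟨-a, by rw [map_inv, ha, unipotentGL_inv]⟩

/-- Membership in `unipSubgroup τ`. [folklore] -/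
theorem mem_unipSubgroup_iff {g : G} : g ∈ unipSubgroup τ ↔ ∃ a : K, τ g = unipotentGL a :=
  Iff.rfl

/-- The elements of `G` mapping to upper triangular matrices. [folklore] -/
def upperSubgroup : Subgroup G where
  carrier := {g | ((τ g : GL (Fin 2) K) : M₂) 1 0 = 0}
  one_mem' := by simp
  mul_mem' := by
    intro x y hx hy
    simp only [Set.mem_setOf_eq] at hx hy ⊢
    rw [map_mul, Units.val_mul, Matrix.mul_apply, Fin.sum_univ_two, hx, hy, zero_mul, mul_zero,
      add_zero]
  inv_mem' := by
    intro x hx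
    simp only [Set.mem_setOf_eq] at hx ⊢
    have hdet : ((τ x : GL (Fin 2) K) : M₂).det ≠ 0 := GL2.det_ne_zero _
    rw [Matrix.det_fin_two, hx, mul_zero, sub_zero] at hdet
    have h1 := congrArg (fun g : GL (Fin 2) K => (g : M₂) 1 0) (mul_inv_cancel (τ x))
    simp only [Units.val_mul, Matrix.mul_apply, Fin.sum_univ_two, Units.val_one, hx, zero_mul,
      zero_add, Matrix.one_apply_ne, ne_eq, one_ne_zero, not_false_eq_true] at h1
    rw [map_inv]
    exact (mul_eq_zero.1 h1).resolve_left (right_ne_zero_of_mul hdet)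

/-- Membership in `upperSubgroup τ`: `(τ g)₁₀ = 0`. [folklore] -/
theorem mem_upperSubgroup_iff {g : G} :
    g ∈ upperSubgroup τ ↔ ((τ g : GL (Fin 2) K) : M₂) 1 0 = 0 :=
  Iff.rfl

/-- Upper unipotent elements are upper triangular. [folklore] -/
theorem unipSubgroup_le_upperSubgroup : unipSubgroup τ ≤ upperSubgroup τ := by
  rintro g ⟨a, ha⟩
  rw [mem_upperSubgroup_iff, ha, coe_unipotentGL]
  simp

/-- The diagonal entries of an invertible upper triangular matrix are non-zero. [folklore] -/
theorem entry_ne_zero_of_mem_upperSubgroup {g : G} (hg : g ∈ upperSubgroup τ) :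
    ((τ g : GL (Fin 2) K) : M₂) 0 0 ≠ 0 ∧ ((τ g : GL (Fin 2) K) : M₂) 1 1 ≠ 0 := by
  have hdet : ((τ g : GL (Fin 2) K) : M₂).det ≠ 0 := GL2.det_ne_zero _
  rw [Matrix.det_fin_two, (mem_upperSubgroup_iff τ).1 hg, mul_zero, sub_zero] at hdet
  exact ⟨left_ne_zero_of_mul hdet, right_ne_zero_of_mul hdet⟩

/-- The ratio `n₀₀ / n₁₁` of the diagonal entries of an upper triangular `τ n`. [folklore] -/
noncomputable def ratio (g : G) : K :=
  ((τ g : GL (Fin 2) K) : M₂) 0 0 / ((τ g : GL (Fin 2) K) : M₂) 1 1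

/-- `ratio(g) ≠ 0` for `g` upper triangular. [folklore] -/
theorem ratio_ne_zero {g : G} (hg : g ∈ upperSubgroup τ) : ratio τ g ≠ 0 :=
  div_ne_zero (entry_ne_zero_of_mem_upperSubgroup τ hg).1
    (entry_ne_zero_of_mem_upperSubgroup τ hg).2

/-- `ratio` is multiplicative on upper triangular elements. [folklore] -/
theorem ratio_mul {g h : G} (hg : g ∈ upperSubgroup τ) (hh : h ∈ upperSubgroup τ) :
    ratio τ (g * h) = ratio τ g * ratio τ h := by
  have hg' := (mem_upperSubgroup_iff τ).1 hg
  have hh' := (mem_upperSubgroup_iff τ).1 hh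
  simp only [ratio, map_mul, Units.val_mul, Matrix.mul_apply, Fin.sum_univ_two, hg', hh',
    mul_zero, add_zero, zero_mul, zero_add]
  rw [div_mul_div_comm]

/-- The ratio character `n ↦ n₀₀ / n₁₁` of the upper triangular elements, valued in `Kˣ`.
[folklore] -/
noncomputable def ratioHom : upperSubgroup τ →* Kˣ where
  toFun g := Units.mk0 (ratio τ g) (ratio_ne_zero τ g.2)
  map_one' := Units.ext (by simp [ratio])
  map_mul' g h := Units.ext (by simp [ratio_mul τ g.2 h.2])

/-- Unfolding lemma for `ratioHom`. [folklore] -/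
theorem coe_ratioHom_apply (g : upperSubgroup τ) : ((ratioHom τ g : Kˣ) : K) = ratio τ g := rfl

/-- Conjugation of a unipotent element by an upper triangular one: `n u_a n⁻¹ = u_{ratio(n) a}`.
[folklore] -/
theorem map_conj_eq_unipotentGL {n g : G} (hn : n ∈ upperSubgroup τ) {a : K}
    (hg : τ g = unipotentGL a) : τ (n * g * n⁻¹) = unipotentGL (ratio τ n * a) := by
  rw [map_mul, map_mul, map_inv, hg, conj_unipotentGL_of_upper ((mem_upperSubgroup_iff τ).1 hn)]
  rfl

variable [CharP K 2]

/-- An element mapping to `u_a` is an involution (`τ` injective, `char K = 2`). [folklore] -/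
theorem mul_self_eq_one_of_map_eq_unipotentGL (hinj : Function.Injective τ) {g : G} {a : K}
    (hg : τ g = unipotentGL a) : g * g = 1 :=
  hinj (by rw [map_mul, hg, unipotentGL_mul_self, map_one])

/-- `unipSubgroup τ` is a `2`-group (of exponent `2`). [folklore] -/
theorem isPGroup_unipSubgroup (hinj : Function.Injective τ) : IsPGroup 2 (unipSubgroup τ) := by
  intro g
  obtain ⟨a, ha⟩ := g.2
  exact ⟨1, Subtype.ext (by
    rw [pow_one, SubmonoidClass.coe_pow, OneMemClass.coe_one, pow_two]
    exact mul_self_eq_one_of_map_eq_unipotentGL τ hinj ha)⟩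

omit [CharP K 2] in
/-- `unipSubgroup τ` is commutative (`u_a u_b = u_b u_a`; `τ` injective). [folklore] -/
theorem isMulCommutative_unipSubgroup (hinj : Function.Injective τ) :
    IsMulCommutative (unipSubgroup τ) :=
  ⟨⟨fun g h => by
    obtain ⟨a, ha⟩ := g.2
    obtain ⟨b, hb⟩ := h.2
    apply Subtype.ext
    rw [MulMemClass.coe_mul, MulMemClass.coe_mul]
    apply hinj
    rw [map_mul, map_mul, ha, hb, unipotentGL_mul, unipotentGL_mul, add_comm]⟩⟩

variable {τ}

/-- If some `τ g₀ = u_{a₀}` with `a₀ ≠ 0`, every `2`-subgroup containing the upper unipotent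
elements consists of upper unipotent elements: its elements are involutions commuting with `g₀`.
[folklore] -/
theorem le_unipSubgroup_of_isPGroup {a₀ : K} (ha₀ : a₀ ≠ 0)
    {g₀ : G} (hg₀ : τ g₀ = unipotentGL a₀) {Q : Subgroup G} (hQ : IsPGroup 2 Q)
    (hle : unipSubgroup τ ≤ Q) : Q ≤ unipSubgroup τ := by
  intro x hx
  have hg₀Q : g₀ ∈ Q := hle ⟨a₀, hg₀⟩
  -- `x` and `x g₀` are involutions
  have hinv : ∀ y ∈ Q, τ y * τ y = 1 := by
    intro y hy
    obtain ⟨k, hk⟩ := hQ ⟨y, hy⟩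
    have hk' : y ^ 2 ^ k = 1 := by
      have := congrArg Subtype.val hk
      simpa using this
    exact mul_self_eq_one_of_pow_two_pow_eq_one (n := k) (by rw [← map_pow, hk', map_one])
  have hxx := hinv x hx
  have hxg := hinv (x * g₀) (Q.mul_mem hx hg₀Q)
  have hgg : τ g₀ * τ g₀ = 1 := by rw [hg₀, unipotentGL_mul_self]
  -- hence `τ x` commutes with `u_{a₀}`
  have hcomm : τ x * τ g₀ = τ g₀ * τ x := by
    rw [map_mul] at hxg
    have h1 : τ x * τ g₀ = (τ x * τ g₀)⁻¹ := (inv_eq_of_mul_eq_one_right hxg).symm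
    rw [h1, mul_inv_rev, inv_eq_of_mul_eq_one_right hxx, inv_eq_of_mul_eq_one_right hgg]
  have hmat := congrArg (fun g : GL (Fin 2) K => (g : M₂) 1 1) hcomm
  simp only [Units.val_mul, hg₀, coe_unipotentGL, Matrix.mul_apply, Fin.sum_univ_two] at hmat
  have h10 : ((τ x : GL (Fin 2) K) : M₂) 1 0 = 0 := by simpa [ha₀] using hmat
  exact ⟨_, eq_unipotentGL_of_mul_self_eq_one hxx h10⟩

/-- **The upper unipotent elements form a Sylow `2`-subgroup** as soon as one of them is
non-trivial. [folklore] -/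
noncomputable def unipSylow (hinj : Function.Injective τ) {a₀ : K} (ha₀ : a₀ ≠ 0) {g₀ : G}
    (hg₀ : τ g₀ = unipotentGL a₀) : Sylow 2 G where
  toSubgroup := unipSubgroup τ
  isPGroup' := isPGroup_unipSubgroup τ hinj
  is_maximal' hQ hle := le_antisymm (le_unipSubgroup_of_isPGroup ha₀ hg₀ hQ hle) hle

/-- The underlying subgroup of `unipSylow` is `unipSubgroup τ`. [folklore] -/
@[simp] theorem coe_unipSylow (hinj : Function.Injective τ) {a₀ : K} (ha₀ : a₀ ≠ 0) {g₀ : G}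
    (hg₀ : τ g₀ = unipotentGL a₀) : (unipSylow hinj ha₀ hg₀ : Subgroup G) = unipSubgroup τ := rfl

omit [CharP K 2] in
/-- The normaliser of the upper unipotent Sylow subgroup consists of upper triangular elements.
[folklore] -/
theorem mem_upperSubgroup_of_mem_normalizer {a₀ : K} (ha₀ : a₀ ≠ 0) {g₀ : G}
    (hg₀ : τ g₀ = unipotentGL a₀) {n : G}
    (hn : n ∈ Subgroup.normalizer (unipSubgroup τ : Set G)) : n ∈ upperSubgroup τ := by
  rw [Subgroup.mem_normalizer_iff] at hn
  obtain ⟨a', ha'⟩ := (hn g₀).1 ⟨a₀, hg₀⟩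
  rw [map_mul, map_mul, map_inv, hg₀, mul_inv_eq_iff_eq_mul] at ha'
  have hmat := congrArg (fun g : GL (Fin 2) K => (g : M₂) 1 1) ha'
  simp only [Units.val_mul, coe_unipotentGL, Matrix.mul_apply, Fin.sum_univ_two] at hmat
  rw [mem_upperSubgroup_iff]
  simpa [ha₀] using hmat

/-- **Irreducibility supplies an involution off the Borel**: if `τ g₀ = u_{a₀}`, `a₀ ≠ 0`, and
`τ(G)` has no common eigenvector, some involution `x ∈ G` has `(τ x)₁₀ ≠ 0`. [folklore] -/
theorem exists_involution_not_upper (hinj : Function.Injective τ) (hirr : ¬ HasCommonEigenvector τ)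
    {a₀ : K} (ha₀ : a₀ ≠ 0) {g₀ : G} (hg₀ : τ g₀ = unipotentGL a₀) :
    ∃ x : G, x * x = 1 ∧ ((τ x : GL (Fin 2) K) : M₂) 1 0 ≠ 0 := by
  by_contra hne
  push Not at hne
  apply hirr
  refine ⟨Pi.single 0 1, by simp, fun h => ⟨((τ h : GL (Fin 2) K) : M₂) 0 0, ?_⟩⟩
  -- `x = h⁻¹ g₀ h` is an upper triangular involution, `≠ 1`
  set x := h⁻¹ * g₀ * h with hx
  have hg₀2 : g₀ * g₀ = 1 := mul_self_eq_one_of_map_eq_unipotentGL τ hinj hg₀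
  have hxx : x * x = 1 := by
    rw [hx, show h⁻¹ * g₀ * h * (h⁻¹ * g₀ * h) = h⁻¹ * (g₀ * g₀) * h by group, hg₀2]; group
  have h10 := hne x hxx
  have hτxx : τ x * τ x = 1 := by rw [← map_mul, hxx, map_one]
  have hxu := eq_unipotentGL_of_mul_self_eq_one hτxx h10
  -- `τ h e₀` is fixed by `u_{a₀}`
  have key : τ h * τ x = τ g₀ * τ h := by
    rw [← map_mul, ← map_mul, hx]; congr 1; group
  have hfix : ((τ g₀ : GL (Fin 2) K) : M₂) *ᵥ (((τ h : GL (Fin 2) K) : M₂) *ᵥ Pi.single 0 1) =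
      ((τ h : GL (Fin 2) K) : M₂) *ᵥ Pi.single 0 1 := by
    have h1 : ((τ x : GL (Fin 2) K) : M₂) *ᵥ (Pi.single 0 1 : Fin 2 → K) = Pi.single 0 1 := by
      rw [hxu, unipotentGL_mulVec]
      ext i; fin_cases i <;> simp
    conv_rhs => rw [← h1]
    rw [Matrix.mulVec_mulVec, Matrix.mulVec_mulVec, ← Units.val_mul, ← Units.val_mul, key]
  rw [hg₀, unipotentGL_mulVec_eq_self_iff ha₀] at hfix
  ext i
  fin_cases i
  · simp [Matrix.mulVec, dotProduct, Fin.sum_univ_two]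
  · simp only [Matrix.mulVec, dotProduct, Fin.sum_univ_two] at hfix ⊢
    simpa using hfix

/-- **All upper unipotent elements `≠ 1` are conjugate to any involution off the Borel** (the
product has non-zero trace, hence odd order, and two involutions with product of odd order are
conjugate). [folklore] -/
theorem exists_conj_eq_of_map_eq_unipotentGL [Finite G] (hinj : Function.Injective τ) {x : G}
    (hxx : x * x = 1) (hx10 : ((τ x : GL (Fin 2) K) : M₂) 1 0 ≠ 0) {g : G} {a : K} (ha : a ≠ 0)
    (hg : τ g = unipotentGL a) : ∃ h : G, h * g * h⁻¹ = x := by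
  refine exists_conj_eq_of_odd_orderOf (mul_self_eq_one_of_map_eq_unipotentGL τ hinj hg) hxx ?_
  rw [← orderOf_injective τ hinj (g * x)]
  refine odd_orderOf_of_trace_ne_zero (τ.isOfFinOrder (isOfFinOrder_of_finite _)) ?_ ?_
  · rw [map_mul, Units.val_mul, hg, trace_unipotentGL_mul,
      trace_eq_zero_of_mul_self_eq_one (by rw [← map_mul, hxx, map_one]), zero_add]
    exact mul_ne_zero ha hx10
  · rw [map_mul, Units.val_mul, hg, coe_unipotentGL]
    simpa [Matrix.mul_apply, Fin.sum_univ_two] using hx10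

/-- **Fusion: the normaliser is transitive on the non-trivial upper unipotent elements.**  By the
previous lemma all `g` with `τ g = u_a`, `a ≠ 0`, are conjugate in `G`; the Sylow `2`-subgroup of
upper unipotent elements being abelian, Burnside's fusion lemma makes them conjugate under its
normaliser, whose elements are upper triangular and act by `a ↦ ratio(n) · a`. [folklore] -/
theorem exists_eq_ratio_mul [Finite G] (hinj : Function.Injective τ)
    (hirr : ¬ HasCommonEigenvector τ) {a₀ : K} (ha₀ : a₀ ≠ 0) {g₀ : G}
    (hg₀ : τ g₀ = unipotentGL a₀) {g : G} {a : K} (ha : a ≠ 0) (hg : τ g = unipotentGL a) :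
    ∃ n ∈ upperSubgroup τ, a = ratio τ n * a₀ := by
  obtain ⟨x, hxx, hx10⟩ := exists_involution_not_upper hinj hirr ha₀ hg₀
  obtain ⟨h₀, hh₀⟩ := exists_conj_eq_of_map_eq_unipotentGL hinj hxx hx10 ha₀ hg₀
  obtain ⟨h, hh⟩ := exists_conj_eq_of_map_eq_unipotentGL hinj hxx hx10 ha hg
  -- `c g₀ c⁻¹ = g` with `c = h⁻¹ h₀`
  have hc : (h⁻¹ * h₀) * g₀ * (h⁻¹ * h₀)⁻¹ = g := by
    rw [← hh] at hh₀
    calc (h⁻¹ * h₀) * g₀ * (h⁻¹ * h₀)⁻¹ = h⁻¹ * (h₀ * g₀ * h₀⁻¹) * h := by group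
      _ = g := by rw [hh₀]; group
  let P : Sylow 2 G := unipSylow hinj ha₀ hg₀
  haveI : IsMulCommutative (P : Subgroup G) := isMulCommutative_unipSubgroup τ hinj
  have hg₀P : g₀ ∈ (P : Subgroup G) := ⟨a₀, hg₀⟩
  have hgP : ((h⁻¹ * h₀)⁻¹)⁻¹ * g₀ * (h⁻¹ * h₀)⁻¹ ∈ (P : Subgroup G) := by
    rw [inv_inv, hc]; exact ⟨a, hg⟩
  obtain ⟨n, hn, hconj⟩ := P.conj_eq_normalizer_conj_of_mem g₀ (h⁻¹ * h₀)⁻¹ hg₀P hgP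
  rw [inv_inv, hc] at hconj
  have hn' : n⁻¹ ∈ upperSubgroup τ :=
    mem_upperSubgroup_of_mem_normalizer ha₀ hg₀ (Subgroup.inv_mem _ hn)
  refine ⟨n⁻¹, hn', unipotentGL_injective ?_⟩
  have key := map_conj_eq_unipotentGL τ hn' hg₀
  rw [inv_inv] at key
  rw [← hg, hconj, key]

/-- **A generator for the multipliers.**  There is an upper triangular `d ∈ G` such that every
`a ≠ 0` with `u_a ∈ τ(G)` is `ratio(d)^j · a₀`: the ratios form a finite, hence cyclic, subgroup
of `Kˣ`. [folklore] -/
theorem exists_forall_eq_ratio_pow_mul [Finite G] (hinj : Function.Injective τ)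
    (hirr : ¬ HasCommonEigenvector τ) {a₀ : K} (ha₀ : a₀ ≠ 0) {g₀ : G}
    (hg₀ : τ g₀ = unipotentGL a₀) :
    ∃ d ∈ upperSubgroup τ, ∀ (g : G) (a : K), a ≠ 0 → τ g = unipotentGL a →
      ∃ j : ℕ, a = ratio τ d ^ j * a₀ := by
  classical
  haveI : Finite (ratioHom τ).range := Finite.of_surjective _ (ratioHom τ).rangeRestrict_surjective
  obtain ⟨γ, hγ⟩ := IsCyclic.exists_generator (α := (ratioHom τ).range)
  obtain ⟨d, hd⟩ := γ.2
  refine ⟨d, d.2, fun g a ha hg => ?_⟩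
  obtain ⟨n, hn, hna⟩ := exists_eq_ratio_mul hinj hirr ha₀ hg₀ ha hg
  have hmem : (⟨ratioHom τ ⟨n, hn⟩, ⟨n, hn⟩, rfl⟩ : (ratioHom τ).range) ∈ Subgroup.zpowers γ :=
    hγ _
  rw [← mem_powers_iff_mem_zpowers] at hmem
  obtain ⟨j, hj⟩ := hmem
  refine ⟨j, ?_⟩
  have hval := congrArg (fun y : (ratioHom τ).range => ((y : Kˣ) : K)) hj
  simp only [SubmonoidClass.coe_pow, Units.val_pow_eq_pow_val] at hval
  rw [hna, ← coe_ratioHom_apply τ ⟨n, hn⟩, ← hval, ← hd, coe_ratioHom_apply]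

/-- **The case `q = 2`: a normal `2`-complement.**  If `u_{a₀}` is the only non-trivial upper
unipotent element of `τ(G)`, the Sylow `2`-subgroup `{1, g₀}` is central in its normaliser, and
Burnside's transfer theorem gives a normal subgroup of odd order and index `2`. [folklore] -/
theorem exists_normal_odd_index_two [Finite G] (hinj : Function.Injective τ) {a₀ : K}
    (ha₀ : a₀ ≠ 0) {g₀ : G} (hg₀ : τ g₀ = unipotentGL a₀)
    (hq : ∀ (g : G) (a : K), τ g = unipotentGL a → a = 0 ∨ a = a₀) :
    ∃ M : Subgroup G, M.Normal ∧ ¬ 2 ∣ Nat.card M ∧ M.index = 2 := by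
  classical
  let P : Sylow 2 G := unipSylow hinj ha₀ hg₀
  have hmemP : ∀ g : G, g ∈ (P : Subgroup G) ↔ g = 1 ∨ g = g₀ := by
    intro g
    constructor
    · rintro ⟨a, ha⟩
      rcases hq g a ha with rfl | rfl
      · left; exact hinj (by rw [ha, unipotentGL_zero, map_one])
      · right; exact hinj (by rw [ha, hg₀])
    · rintro (rfl | rfl)
      · exact Subgroup.one_mem _
      · exact ⟨a₀, hg₀⟩
  have hg₀1 : g₀ ≠ 1 := by
    intro h
    rw [h, map_one, ← unipotentGL_zero] at hg₀
    exact ha₀ (unipotentGL_injective hg₀).symm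
  have hN : Subgroup.normalizer ((P : Subgroup G) : Set G) ≤
      Subgroup.centralizer ((P : Subgroup G) : Set G) := by
    intro n hn
    rw [Subgroup.mem_centralizer_iff]
    intro s hs
    rcases (hmemP s).1 hs with h | h
    · rw [h, one_mul, mul_one]
    · rw [h]
      have h1 := ((Subgroup.mem_normalizer_iff).1 hn g₀).1 ((hmemP g₀).2 (Or.inr rfl))
      rcases (hmemP _).1 h1 with h2 | h2
      · exfalso; apply hg₀1
        calc g₀ = n⁻¹ * (n * g₀ * n⁻¹) * n := by group
          _ = 1 := by rw [h2]; group
      · have := congrArg (· * n) h2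
        simpa using this.symm
  refine ⟨(MonoidHom.transferSylow P hN).ker, inferInstance,
    MonoidHom.not_dvd_card_ker_transferSylow P hN, ?_⟩
  rw [(MonoidHom.ker_transferSylow_isComplement' P hN).symm.index_eq_card]
  rw [Nat.card_eq_two_iff]
  refine ⟨⟨1, (hmemP 1).2 (Or.inl rfl)⟩, ⟨g₀, (hmemP g₀).2 (Or.inr rfl)⟩,
    fun h => hg₀1 (congrArg Subtype.val h).symm, ?_⟩
  ext ⟨s, hs⟩
  simp only [Set.mem_insert_iff, Set.mem_singleton_iff, Set.mem_univ, iff_true]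
  rcases (hmemP s).1 hs with rfl | rfl
  · exact Or.inl rfl
  · exact Or.inr rfl

end Group

/-! ### Adequacy in normal form: clauses (i) and (iii) -/

section NormalForm

variable {G : Type*} [Group G] [Finite G] {τ : G →* GL (Fin 2) K} [CharP K 2]

omit [Finite G] [CharP K 2] in
/-- Powers of the diagonal generator conjugate `g₀` to the element with parameter `ratio(d)^j a₀`.
[folklore] -/
theorem map_pow_conj_eq_unipotentGL {d : G} (hd : d ∈ upperSubgroup τ) {g₀ : G} {a₀ : K}
    (hg₀ : τ g₀ = unipotentGL a₀) (j : ℕ) :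
    τ (d ^ j * g₀ * (d ^ j)⁻¹) = unipotentGL (ratio τ d ^ j * a₀) := by
  induction j with
  | zero => simp [hg₀]
  | succ j ih =>
    have e : d ^ (j + 1) * g₀ * (d ^ (j + 1))⁻¹ = d * (d ^ j * g₀ * (d ^ j)⁻¹) * d⁻¹ := by
      rw [pow_succ']; group
    rw [e, map_conj_eq_unipotentGL τ hd ih, pow_succ']
    ring_nf

omit [Finite G] [CharP K 2] in
/-- `ratio d ≠ 1` as soon as two distinct non-trivial upper unipotent elements exist. [folklore] -/
theorem ratio_ne_one {d : G} {a₀ : K}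
    (htrans : ∀ (g : G) (a : K), a ≠ 0 → τ g = unipotentGL a → ∃ j : ℕ, a = ratio τ d ^ j * a₀)
    {g₁ : G} {a₁ : K} (ha₁ : a₁ ≠ 0) (ha₁₀ : a₁ ≠ a₀) (hg₁ : τ g₁ = unipotentGL a₁) :
    ratio τ d ≠ 1 := by
  intro h1
  obtain ⟨j, hj⟩ := htrans g₁ a₁ ha₁ hg₁
  rw [h1, one_pow, one_mul] at hj
  exact ha₁₀ hj

omit [Finite G] in
/-- The "doubling" map `g ↦ (d g d⁻¹) g` of the upper unipotent subgroup is injective when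
`ratio d ≠ 1` (it multiplies the parameter by `ratio d + 1 ≠ 0`). [folklore] -/
theorem conj_mul_self_injective (hinj : Function.Injective τ) {d : G} (hd : d ∈ upperSubgroup τ)
    (hr : ratio τ d ≠ 1) :
    Function.Injective (fun g : unipSubgroup τ =>
      (⟨d * g * d⁻¹ * g, (unipSubgroup τ).mul_mem
        (by obtain ⟨a, ha⟩ := g.2; exact ⟨_, map_conj_eq_unipotentGL τ hd ha⟩) g.2⟩ :
        unipSubgroup τ)) := by
  intro g g' hgg'
  obtain ⟨a, ha⟩ := g.2
  obtain ⟨b, hb⟩ := g'.2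
  have h := congrArg (fun x : unipSubgroup τ => τ (x : G)) hgg'
  simp only [map_mul, map_conj_eq_unipotentGL τ hd ha, map_conj_eq_unipotentGL τ hd hb, ha, hb,
    unipotentGL_mul] at h
  have hab : (ratio τ d + 1) * a = (ratio τ d + 1) * b := by
    have := unipotentGL_injective h
    linear_combination this
  have hr1 : ratio τ d + 1 ≠ 0 := by
    intro h0
    apply hr
    have : ratio τ d = -1 := eq_neg_of_add_eq_zero_left h0
    rw [this, CharTwo.neg_eq]
  have hab' : a = b := mul_left_cancel₀ hr1 hab
  apply Subtype.ext
  apply hinj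
  rw [ha, hb, hab']

/-- **Clause (i) in normal form: `Hom(G, K) = 0`.**  An additive character `φ` is invariant under
conjugation, so `φ((d g d⁻¹) g) = 2 φ(g) = 0` on the upper unipotent subgroup, on which the
doubling map is onto; every involution is conjugate into that subgroup, and `φ(h) = m⁻¹ φ(h^m)`
with `h^m` a `2`-element, i.e. an involution. [folklore] -/
theorem addMonoidHom_eq_zero_of_normalForm (hinj : Function.Injective τ)
    {a₀ : K} (ha₀ : a₀ ≠ 0) {g₀ : G}
    (hg₀ : τ g₀ = unipotentGL a₀) {d : G} (hd : d ∈ upperSubgroup τ) (hr : ratio τ d ≠ 1)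
    (F : Additive τ.range →+ K) : F = 0 := by
  classical
  -- pull back to `G`
  let φ : Additive G →+ K := F.comp (MonoidHom.toAdditive τ.rangeRestrict)
  have hφ : ∀ g : G, φ (Additive.ofMul g) = F (Additive.ofMul (τ.rangeRestrict g)) := fun g => rfl
  suffices hφ0 : ∀ g : G, φ (Additive.ofMul g) = 0 by
    refine AddMonoidHom.ext fun x => ?_
    obtain ⟨g, hg⟩ := τ.rangeRestrict_surjective (Additive.toMul x)
    have := hφ0 g
    rw [hφ, hg, ofMul_toMul] at this
    rwa [AddMonoidHom.zero_apply]
  have hmul : ∀ g h : G, φ (Additive.ofMul (g * h)) = φ (Additive.ofMul g) + φ (Additive.ofMul h) :=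
    fun g h => by rw [ofMul_mul, map_add]
  have hone : φ (Additive.ofMul (1 : G)) = 0 := by rw [ofMul_one, map_zero]
  have hinv : ∀ g : G, φ (Additive.ofMul g⁻¹) = -φ (Additive.ofMul g) := fun g => by
    rw [ofMul_inv, map_neg]
  have hconj : ∀ g h : G, φ (Additive.ofMul (h * g * h⁻¹)) = φ (Additive.ofMul g) := fun g h => by
    rw [hmul, hmul, hinv]; ring
  -- (1) `φ` vanishes on the upper unipotent subgroup
  have hS : ∀ g ∈ unipSubgroup τ, φ (Additive.ofMul g) = 0 := by
    intro g hg
    obtain ⟨g', hg'⟩ := (Finite.surjective_of_injective (conj_mul_self_injective hinj hd hr)) ⟨g, hg⟩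
    have e : d * (g' : G) * d⁻¹ * g' = g := congrArg Subtype.val hg'
    rw [← e, hmul, hconj, ← two_mul, CharTwo.two_eq_zero, zero_mul]
  -- (2) `φ` vanishes on involutions
  have hinvol : ∀ x : G, x * x = 1 → φ (Additive.ofMul x) = 0 := by
    intro x hxx
    by_cases h10 : ((τ x : GL (Fin 2) K) : M₂) 1 0 = 0
    · exact hS x ⟨_, eq_unipotentGL_of_mul_self_eq_one (by rw [← map_mul, hxx, map_one]) h10⟩
    · obtain ⟨h, hh⟩ := exists_conj_eq_of_map_eq_unipotentGL hinj hxx h10 ha₀ hg₀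
      rw [← hh, hconj]
      exact hS g₀ ⟨a₀, hg₀⟩
  -- (3) every element
  intro g
  obtain ⟨e, m, hm, hem⟩ := Nat.exists_eq_two_pow_mul_odd (orderOf_pos g).ne'
  have hy : g ^ m * g ^ m = 1 := by
    apply hinj
    rw [map_mul, map_one]
    refine mul_self_eq_one_of_pow_two_pow_eq_one (n := e) ?_
    rw [← map_pow, ← pow_mul, mul_comm, ← hem, pow_orderOf_eq_one, map_one]
  have h1 := hinvol _ hy
  rw [ofMul_pow, map_nsmul, nsmul_eq_mul] at h1
  have hm0 : (m : K) ≠ 0 := by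
    intro h0
    rw [CharP.cast_eq_zero_iff K 2] at h0
    exact hm.not_two_dvd_nat h0
  exact (mul_eq_zero.1 h1).resolve_left hm0

omit [Finite G] in
/-- The matrix of an element of `G` whose image has odd order lies in the semisimple span.
[folklore] -/
theorem coe_map_mem_semisimpleSpan {g : G} (hodd : Odd (orderOf (τ g))) :
    ((τ g : GL (Fin 2) K) : M₂) ∈ Subgroup.semisimpleSpan τ.range := by
  have h := Subgroup.mem_semisimpleSpan_of_coprime τ.range ⟨τ g, g, rfl⟩ (by
    rw [ringChar.eq K 2, Nat.coprime_comm, Nat.Prime.coprime_iff_not_dvd Nat.prime_two]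
    exact hodd.not_two_dvd_nat)
  exact h

/-- **Clause (iii) in normal form: the semisimple elements span `M₂(K)`.**  With `X = τ x` an
involution off the Borel (`z = X₁₀ ≠ 0`), the products `u_a X` (`a ≠ 0`) have odd order; their
differences give `R = E₀₁ X`, conjugating `R` by `u_{a₀}` gives `E₀₁`, and then `E₀₀`, `E₁₁`,
`X` and `E₁₀` follow. [folklore] -/
theorem semisimpleSpan_eq_top_of_normalForm (hinj : Function.Injective τ)
    (hirr : ¬ HasCommonEigenvector τ) {a₀ : K} (ha₀ : a₀ ≠ 0) {g₀ : G}
    (hg₀ : τ g₀ = unipotentGL a₀) {g₁ : G} {a₁ : K} (ha₁ : a₁ ≠ 0) (ha₁₀ : a₁ ≠ a₀)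
    (hg₁ : τ g₁ = unipotentGL a₁) : Subgroup.semisimpleSpan τ.range = ⊤ := by
  classical
  obtain ⟨x, hxx, hz⟩ := exists_involution_not_upper hinj hirr ha₀ hg₀
  set Sp := Subgroup.semisimpleSpan τ.range with hSp
  set X : M₂ := ((τ x : GL (Fin 2) K) : M₂) with hX
  have htrX : X.trace = 0 := trace_eq_zero_of_mul_self_eq_one (by rw [← map_mul, hxx, map_one])
  rw [Matrix.trace_fin_two] at htrX
  -- the odd-order products `u_a X`
  have hprod : ∀ {g : G} {a : K}, a ≠ 0 → τ g = unipotentGL a →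
      ((unipotentGL a : GL (Fin 2) K) : M₂) * X ∈ Sp := by
    intro g a ha hg
    have hmem := coe_map_mem_semisimpleSpan (τ := τ) (g := g * x) ?_
    · rwa [map_mul, Units.val_mul, hg] at hmem
    · refine odd_orderOf_of_trace_ne_zero (τ.isOfFinOrder (isOfFinOrder_of_finite _)) ?_ ?_
      · rw [map_mul, Units.val_mul, hg, trace_unipotentGL_mul, ← hX, Matrix.trace_fin_two, htrX,
          zero_add]
        exact mul_ne_zero ha hz
      · rw [map_mul, Units.val_mul, hg, coe_unipotentGL, ← hX]
        simpa [Matrix.mul_apply, Fin.sum_univ_two] using hz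
  have hp₀ := hprod ha₀ hg₀
  have hp₁ := hprod ha₁ hg₁
  -- `R = E₀₁ X = (z, x₁₁; 0, 0)`
  set R : M₂ := !![X 1 0, X 1 1; 0, 0] with hR
  have hRdiff : ((unipotentGL a₀ : GL (Fin 2) K) : M₂) * X - ((unipotentGL a₁ : GL (Fin 2) K) : M₂) * X
      = (a₀ - a₁) • R := by
    rw [hR, coe_unipotentGL, coe_unipotentGL, Matrix.eta_fin_two X]
    ext i j
    fin_cases i <;> fin_cases j <;> simp <;> ring
  have hRmem : R ∈ Sp := by
    have h : (a₀ - a₁)⁻¹ • ((a₀ - a₁) • R) ∈ Sp := by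
      rw [← hRdiff]
      exact Sp.smul_mem _ (Sp.sub_mem hp₀ hp₁)
    rwa [smul_smul, inv_mul_cancel₀ (sub_ne_zero.2 (Ne.symm ha₁₀)), one_smul] at h
  -- conjugate `R` by `u_{a₀}`: `u R u⁻¹ = R + (a₀ z) E₀₁`
  have hconjR : Subgroup.adRep τ.range ⟨τ g₀, g₀, rfl⟩ R = R + (a₀ * X 1 0) • !![0, 1; 0, 0] := by
    rw [Subgroup.adRep_apply]
    change ((τ g₀ : GL (Fin 2) K) : M₂) * R * (((τ g₀)⁻¹ : GL (Fin 2) K) : M₂) = _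
    rw [hg₀, unipotentGL_inv, coe_unipotentGL, coe_unipotentGL, hR]
    ext i j
    fin_cases i <;> fin_cases j <;> simp [CharTwo.neg_eq]
    ring
  have hE01 : (!![0, 1; 0, 0] : M₂) ∈ Sp := by
    have h1 : Subgroup.adRep τ.range ⟨τ g₀, g₀, rfl⟩ R - R ∈ Sp :=
      Sp.sub_mem (Subgroup.adRep_apply_mem_semisimpleSpan τ.range _ hRmem) hRmem
    rw [hconjR, add_sub_cancel_left] at h1
    have h2 := Sp.smul_mem (a₀ * X 1 0)⁻¹ h1
    rwa [smul_smul, inv_mul_cancel₀ (mul_ne_zero ha₀ hz), one_smul] at h2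
  have hE00 : (!![1, 0; 0, 0] : M₂) ∈ Sp := by
    have h1 : R - X 1 1 • (!![0, 1; 0, 0] : M₂) = X 1 0 • !![1, 0; 0, 0] := by
      rw [hR]
      ext i j
      fin_cases i <;> fin_cases j <;> simp
    have h2 : (X 1 0)⁻¹ • (X 1 0 • (!![1, 0; 0, 0] : M₂)) ∈ Sp := by
      rw [← h1]
      exact Sp.smul_mem _ (Sp.sub_mem hRmem (Sp.smul_mem _ hE01))
    rwa [smul_smul, inv_mul_cancel₀ hz, one_smul] at h2
  have hone : (1 : M₂) ∈ Sp := Subgroup.one_mem_semisimpleSpan _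
  have hE11 : (!![0, 0; 0, 1] : M₂) ∈ Sp := by
    have h1 : (1 : M₂) - !![1, 0; 0, 0] = !![0, 0; 0, 1] := by
      ext i j
      fin_cases i <;> fin_cases j <;> simp
    rw [← h1]
    exact Sp.sub_mem hone hE00
  have hXmem : X ∈ Sp := by
    have h1 : ((unipotentGL a₀ : GL (Fin 2) K) : M₂) * X - a₀ • R = X := by
      rw [hR, coe_unipotentGL, Matrix.eta_fin_two X]
      ext i j
      fin_cases i <;> fin_cases j <;> simp
    rw [← h1]
    exact Sp.sub_mem hp₀ (Sp.smul_mem _ hRmem)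
  have hE10 : (!![0, 0; 1, 0] : M₂) ∈ Sp := by
    have h1 : X - X 0 0 • (!![1, 0; 0, 0] : M₂) - X 0 1 • !![0, 1; 0, 0] - X 1 1 • !![0, 0; 0, 1] =
        X 1 0 • !![0, 0; 1, 0] := by
      rw [Matrix.eta_fin_two X]
      ext i j
      fin_cases i <;> fin_cases j <;> simp
    have h2 : (X 1 0)⁻¹ • (X 1 0 • (!![0, 0; 1, 0] : M₂)) ∈ Sp := by
      rw [← h1]
      exact Sp.smul_mem _ (Sp.sub_mem (Sp.sub_mem (Sp.sub_mem hXmem (Sp.smul_mem _ hE00))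
        (Sp.smul_mem _ hE01)) (Sp.smul_mem _ hE11))
    rwa [smul_smul, inv_mul_cancel₀ hz, one_smul] at h2
  -- everything
  rw [eq_top_iff]
  rintro M -
  have hM : M = M 0 0 • (!![1, 0; 0, 0] : M₂) + M 0 1 • !![0, 1; 0, 0] + M 1 0 • !![0, 0; 1, 0] +
      M 1 1 • !![0, 0; 0, 1] := by
    conv_lhs => rw [Matrix.eta_fin_two M]
    ext i j
    fin_cases i <;> fin_cases j <;> simp
  rw [hM]
  exact Sp.add_mem (Sp.add_mem (Sp.add_mem (Sp.smul_mem _ hE00) (Sp.smul_mem _ hE01))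
    (Sp.smul_mem _ hE10)) (Sp.smul_mem _ hE11)

end NormalForm

/-! ### Clause (ii) in normal form: coordinates on `ad/Z` -/

section Coordinates

variable {G : Type*} [Group G] {τ : G →* GL (Fin 2) K}

local notation "W₂" => Matrix (Fin 2) (Fin 2) K ⧸ scalarMatrices (Fin 2) K

/-- `ad/Z` as a representation of `G` through `τ`. [folklore] -/
abbrev adz (τ : G →* GL (Fin 2) K) : Representation K G W₂ := (adModScalar (Fin 2) K).comp τ

/-- Unfolding lemma: `g • [M] = [τ(g) M τ(g)⁻¹]` on `ad/Z`. [folklore] -/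
theorem adz_apply_mk (g : G) (M : M₂) :
    adz τ g (Submodule.Quotient.mk M) =
      Submodule.Quotient.mk (((τ g : GL (Fin 2) K) : M₂) * M * (((τ g)⁻¹ : GL (Fin 2) K) : M₂)) :=
  rfl

/-- The `(i, j)` entry as a linear form on `M₂(K)`. [folklore] -/
def entryForm (i j : Fin 2) : M₂ →ₗ[K] K where
  toFun M := M i j
  map_add' _ _ := rfl
  map_smul' _ _ := rfl

/-- Unfolding lemma for `entryForm`. [folklore] -/
@[simp] theorem entryForm_apply (i j : Fin 2) (M : M₂) : entryForm i j M = M i j := rfl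

/-- A linear form on `M₂(K)` descends to `ad/Z` iff it kills `1`. [folklore] -/
theorem scalarMatrices_le_ker_iff (l : M₂ →ₗ[K] K) :
    scalarMatrices (Fin 2) K ≤ LinearMap.ker l ↔ l 1 = 0 := by
  rw [scalarMatrices, Submodule.span_singleton_le_iff_mem, LinearMap.mem_ker]

/-- The linear form `[M] ↦ M₀₀ - M₁₁` on `ad/Z`. [folklore] -/
def diagDiffQ : W₂ →ₗ[K] K :=
  (scalarMatrices (Fin 2) K).liftQ (entryForm 0 0 - entryForm 1 1)
    ((scalarMatrices_le_ker_iff _).2 (by simp))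

/-- The linear form `[M] ↦ M₀₁` on `ad/Z`. [folklore] -/
def entry01Q : W₂ →ₗ[K] K :=
  (scalarMatrices (Fin 2) K).liftQ (entryForm 0 1) ((scalarMatrices_le_ker_iff _).2 (by simp))

/-- The linear form `[M] ↦ M₁₀` on `ad/Z`. [folklore] -/
def entry10Q : W₂ →ₗ[K] K :=
  (scalarMatrices (Fin 2) K).liftQ (entryForm 1 0) ((scalarMatrices_le_ker_iff _).2 (by simp))

/-- `diagDiffQ [M] = M₀₀ - M₁₁`. [folklore] -/
@[simp] theorem diagDiffQ_mk (M : M₂) :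
    diagDiffQ (Submodule.Quotient.mk M : W₂) = M 0 0 - M 1 1 := rfl

/-- `entry01Q [M] = M₀₁`. [folklore] -/
@[simp] theorem entry01Q_mk (M : M₂) : entry01Q (Submodule.Quotient.mk M : W₂) = M 0 1 := rfl

/-- `entry10Q [M] = M₁₀`. [folklore] -/
@[simp] theorem entry10Q_mk (M : M₂) : entry10Q (Submodule.Quotient.mk M : W₂) = M 1 0 := rfl

/-- The three forms detect `0` in `ad/Z`. [folklore] -/
theorem quot_eq_zero {w : W₂} (h1 : diagDiffQ w = 0) (h2 : entry01Q w = 0)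
    (h3 : entry10Q w = 0) : w = 0 := by
  obtain ⟨M, rfl⟩ := Submodule.Quotient.mk_surjective _ w
  simp only [diagDiffQ_mk, entry01Q_mk, entry10Q_mk] at h1 h2 h3
  rw [Submodule.Quotient.mk_eq_zero, mem_scalarMatrices_iff]
  refine ⟨M 0 0, ?_⟩
  rw [Matrix.eta_fin_two M]
  ext i j
  fin_cases i <;> fin_cases j <;> simp [h2, h3]
  linear_combination h1

/-- Two classes in `ad/Z` with the same three coordinates are equal. [folklore] -/
theorem quot_eq_of_forms {w w' : W₂} (h1 : diagDiffQ w = diagDiffQ w')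
    (h2 : entry01Q w = entry01Q w') (h3 : entry10Q w = entry10Q w') : w = w' := by
  rw [← sub_eq_zero]
  exact quot_eq_zero (by rw [map_sub, h1, sub_self]) (by rw [map_sub, h2, sub_self])
    (by rw [map_sub, h3, sub_self])

/-- **Coordinates of the action of `u_a` on `ad/Z`** (`char K = 2`):
`(δ, y, z) ↦ (δ, y + a δ + a² z, z)`. [folklore] -/
theorem forms_adz_of_unipotentGL [CharP K 2] {g : G} {a : K} (hg : τ g = unipotentGL a) (w : W₂) :
    diagDiffQ (adz τ g w) = diagDiffQ w ∧ entry10Q (adz τ g w) = entry10Q w ∧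
      entry01Q (adz τ g w) = entry01Q w + a * diagDiffQ w + a ^ 2 * entry10Q w := by
  obtain ⟨M, rfl⟩ := Submodule.Quotient.mk_surjective _ w
  have h2 : (2 : K) = 0 := CharTwo.two_eq_zero
  rw [adz_apply_mk, hg, unipotentGL_inv]
  simp only [coe_unipotentGL, diagDiffQ_mk, entry01Q_mk, entry10Q_mk]
  rw [Matrix.eta_fin_two M]
  refine ⟨?_, ?_, ?_⟩
  · simp [Matrix.mul_apply, Fin.sum_univ_two]
    linear_combination (a * M 1 0) * h2
  · simp [Matrix.mul_apply, Fin.sum_univ_two]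
  · simp [Matrix.mul_apply, Fin.sum_univ_two]
    linear_combination (-(a * (M 0 0 - M 1 1)) - a ^ 2 * M 1 0) * h2

/-- **Coordinates of the action of a diagonal element on `ad/Z`**:
`(δ, y, z) ↦ (δ, r y, r⁻¹ z)`, `r = ratio`. [folklore] -/
theorem forms_adz_of_diag {d : G} (hd01 : ((τ d : GL (Fin 2) K) : M₂) 0 1 = 0)
    (hd10 : ((τ d : GL (Fin 2) K) : M₂) 1 0 = 0) (w : W₂) :
    diagDiffQ (adz τ d w) = diagDiffQ w ∧ entry01Q (adz τ d w) = ratio τ d * entry01Q w ∧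
      entry10Q (adz τ d w) = (ratio τ d)⁻¹ * entry10Q w := by
  obtain ⟨M, rfl⟩ := Submodule.Quotient.mk_surjective _ w
  set D : M₂ := ((τ d : GL (Fin 2) K) : M₂) with hD
  set I : M₂ := (((τ d)⁻¹ : GL (Fin 2) K) : M₂) with hI
  have hmul : D * I = 1 := by rw [hD, hI, ← Units.val_mul, mul_inv_cancel, Units.val_one]
  have e00 := congrFun (congrFun hmul 0) 0
  rw [Matrix.mul_apply, Fin.sum_univ_two, Matrix.one_apply_eq, hd01, zero_mul, add_zero] at e00
  have e01 := congrFun (congrFun hmul 0) 1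
  rw [Matrix.mul_apply, Fin.sum_univ_two, Matrix.one_apply_ne (by decide), hd01, zero_mul,
    add_zero] at e01
  have e10 := congrFun (congrFun hmul 1) 0
  rw [Matrix.mul_apply, Fin.sum_univ_two, Matrix.one_apply_ne (by decide), hd10, zero_mul,
    zero_add] at e10
  have e11 := congrFun (congrFun hmul 1) 1
  rw [Matrix.mul_apply, Fin.sum_univ_two, Matrix.one_apply_eq, hd10, zero_mul, zero_add] at e11
  have hα : D 0 0 ≠ 0 := left_ne_zero_of_mul_eq_one e00
  have hδ : D 1 1 ≠ 0 := left_ne_zero_of_mul_eq_one e11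
  have i00 : I 0 0 = (D 0 0)⁻¹ := (inv_eq_of_mul_eq_one_right e00).symm
  have i11 : I 1 1 = (D 1 1)⁻¹ := (inv_eq_of_mul_eq_one_right e11).symm
  have i01 : I 0 1 = 0 := (mul_eq_zero.1 e01).resolve_left hα
  have i10 : I 1 0 = 0 := (mul_eq_zero.1 e10).resolve_left hδ
  rw [adz_apply_mk]
  simp only [diagDiffQ_mk, entry01Q_mk, entry10Q_mk, ratio]
  rw [← hD, ← hI, Matrix.eta_fin_two M, Matrix.eta_fin_two D, Matrix.eta_fin_two I]
  simp only [hd01, hd10, i00, i01, i10, i11]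
  refine ⟨?_, ?_, ?_⟩
  · simp [Matrix.mul_apply, Fin.sum_univ_two]
    field_simp
  · simp [Matrix.mul_apply, Fin.sum_univ_two]
    field_simp
  · simp [Matrix.mul_apply, Fin.sum_univ_two]
    field_simp

/-- Diagonal elements fix the class of `E₀₀` in `ad/Z`. [folklore] -/
theorem adz_diag_E00 {d : G} (hd01 : ((τ d : GL (Fin 2) K) : M₂) 0 1 = 0)
    (hd10 : ((τ d : GL (Fin 2) K) : M₂) 1 0 = 0) (c : K) :
    adz τ d (Submodule.Quotient.mk (c • !![1, 0; 0, 0] : M₂)) =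
      Submodule.Quotient.mk (c • !![1, 0; 0, 0] : M₂) := by
  obtain ⟨h1, h2, h3⟩ := forms_adz_of_diag hd01 hd10 (Submodule.Quotient.mk (c • !![1, 0; 0, 0] : M₂))
  exact quot_eq_of_forms h1 (by rw [h2]; simp) (by rw [h3]; simp)

end Coordinates

/-! ### Clause (ii) in normal form: the cocycle computation -/

section Cohomology

variable {G : Type*} [Group G] [Finite G] {τ : G →* GL (Fin 2) K} [CharP K 2]

local notation "W₂" => Matrix (Fin 2) (Fin 2) K ⧸ scalarMatrices (Fin 2) K

omit [Finite G] [CharP K 2] in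
/-- Powers of an element with diagonal image have diagonal image. [folklore] -/
theorem isDg_map_pow {d : G} (hd : GL2.IsDg ((τ d : GL (Fin 2) K) : M₂)) (n : ℕ) :
    GL2.IsDg ((τ (d ^ n) : GL (Fin 2) K) : M₂) := by
  induction n with
  | zero => rw [pow_zero, map_one, Units.val_one]; exact GL2.isDg_one
  | succ n ih => rw [pow_succ, map_mul, Units.val_mul]; exact ih.mul hd

/-- An element with diagonal image has odd order (`char K = 2`, `τ` injective): a power of order
`2` would be a diagonal involution, i.e. trivial. [folklore] -/
theorem odd_orderOf_of_diag (hinj : Function.Injective τ) {d : G}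
    (hd01 : ((τ d : GL (Fin 2) K) : M₂) 0 1 = 0) (hd10 : ((τ d : GL (Fin 2) K) : M₂) 1 0 = 0) :
    Odd (orderOf d) := by
  by_contra hodd
  rw [Nat.not_odd_iff_even, even_iff_two_dvd] at hodd
  obtain ⟨m, hm⟩ := hodd
  have hpos : 0 < orderOf d := orderOf_pos d
  have hm0 : m ≠ 0 := by rintro rfl; omega
  have hy1 : d ^ m ≠ 1 := pow_ne_one_of_lt_orderOf hm0 (by omega)
  have hyy : τ (d ^ m) * τ (d ^ m) = 1 := by
    rw [← map_mul, ← pow_add, ← two_mul, ← hm, pow_orderOf_eq_one, map_one]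
  have hdg := isDg_map_pow (τ := τ) ⟨hd01, hd10⟩ m
  have hu := eq_unipotentGL_of_mul_self_eq_one hyy hdg.2
  rw [hdg.1, unipotentGL_zero] at hu
  exact hy1 (hinj (by rw [hu, map_one]))

/-- **The heart of clause (ii).**  A `1`-cocycle `f : G → ad/Z` vanishing on `⟨d⟩` is a
coboundary on `U ⊔ ⟨d⟩` (`U` the upper unipotent elements): in the coordinates `(δ, y, z)` its
components on `U` satisfy `δ = 0` (doubling map), `z = 0` (`f(g²) = 0`), and
`y(u_a) = x₀ a` (transitivity of `⟨ratio d⟩` on the parameters), which is the coboundary of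
`x₀ E₀₀`, a class fixed by `d`. [folklore] -/
theorem exists_eq_sub_sup_zpowers (hinj : Function.Injective τ) {a₀ : K} (ha₀ : a₀ ≠ 0) {g₀ : G}
    (hg₀ : τ g₀ = unipotentGL a₀) {d : G} (hd01 : ((τ d : GL (Fin 2) K) : M₂) 0 1 = 0)
    (hd10 : ((τ d : GL (Fin 2) K) : M₂) 1 0 = 0) (hr : ratio τ d ≠ 1)
    (htrans : ∀ (g : G) (a : K), a ≠ 0 → τ g = unipotentGL a → ∃ j : ℕ, a = ratio τ d ^ j * a₀)
    (f : G → W₂) (hf : ∀ g h, f (g * h) = adz τ g (f h) + f g)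
    (hfd : ∀ x ∈ Subgroup.zpowers d, f x = 0) :
    ∃ m : W₂, ∀ x ∈ unipSubgroup τ ⊔ Subgroup.zpowers d, f x = adz τ x m - m := by
  classical
  have hd : d ∈ upperSubgroup τ := (mem_upperSubgroup_iff τ).2 hd10
  have hf1 : f 1 = 0 := MonomialAdequacy.cocycle_apply_one _ f hf
  -- equivariance under `d`
  have heq : ∀ g : G, f (d * g * d⁻¹) = adz τ d (f g) := by
    intro g
    rw [hf, hf, hfd d⁻¹ (Subgroup.inv_mem _ (Subgroup.mem_zpowers d)),
      hfd d (Subgroup.mem_zpowers d), map_zero, zero_add, add_zero]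
  -- additivity of the coordinates on `U`
  have hadd : ∀ {g h : G} {a : K}, τ g = unipotentGL a →
      diagDiffQ (f (g * h)) = diagDiffQ (f h) + diagDiffQ (f g) ∧
      entry10Q (f (g * h)) = entry10Q (f h) + entry10Q (f g) ∧
      entry01Q (f (g * h)) = entry01Q (f h) + a * diagDiffQ (f h) + a ^ 2 * entry10Q (f h) +
        entry01Q (f g) := by
    intro g h a hg
    obtain ⟨h1, h2, h3⟩ := forms_adz_of_unipotentGL hg (f h)
    rw [hf, map_add, map_add, map_add, h1, h2, h3]
    exact ⟨rfl, rfl, rfl⟩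
  -- (c1) `δ = 0` on `U`
  have hδ : ∀ g ∈ unipSubgroup τ, diagDiffQ (f g) = 0 := by
    intro g hg
    obtain ⟨g', hg'⟩ := (Finite.surjective_of_injective (conj_mul_self_injective hinj hd hr)) ⟨g, hg⟩
    have e : d * (g' : G) * d⁻¹ * g' = g := congrArg Subtype.val hg'
    obtain ⟨b, hb⟩ := g'.2
    have h1 := (hadd (h := (g' : G)) (map_conj_eq_unipotentGL τ hd hb)).1
    have h2 : (2 : K) = 0 := CharTwo.two_eq_zero
    rw [e, heq, (forms_adz_of_diag hd01 hd10 _).1, ← two_mul, h2, zero_mul] at h1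
    exact h1
  -- (c2) `z = 0` on `U`
  have hz : ∀ (g : G) (a : K), τ g = unipotentGL a → entry10Q (f g) = 0 := by
    intro g a hg
    by_cases ha : a = 0
    · have : g = 1 := hinj (by rw [hg, ha, unipotentGL_zero, map_one])
      rw [this, hf1, map_zero]
    · have h3 := (hadd (h := g) hg).2.2
      rw [mul_self_eq_one_of_map_eq_unipotentGL τ hinj hg, hf1, map_zero, hδ g ⟨a, hg⟩, mul_zero,
        add_zero] at h3
      -- `0 = y + a² z + y`
      have h4 : a ^ 2 * entry10Q (f g) = 0 := by
        have h2 : (2 : K) = 0 := CharTwo.two_eq_zero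
        linear_combination -h3 - entry01Q (f g) * h2
      exact (mul_eq_zero.1 h4).resolve_left (pow_ne_zero 2 ha)
  -- (c3) `y(u_a) = x₀ a`
  set x₀ : K := entry01Q (f g₀) / a₀ with hx₀
  have hypow : ∀ j : ℕ, entry01Q (f (d ^ j * g₀ * (d ^ j)⁻¹)) = ratio τ d ^ j * entry01Q (f g₀) := by
    intro j
    induction j with
    | zero => simp
    | succ j ih =>
      have e : d ^ (j + 1) * g₀ * (d ^ (j + 1))⁻¹ = d * (d ^ j * g₀ * (d ^ j)⁻¹) * d⁻¹ := by
        rw [pow_succ']; group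
      rw [e, heq, (forms_adz_of_diag hd01 hd10 _).2.1, ih, pow_succ']
      ring
  have hy : ∀ (g : G) (a : K), τ g = unipotentGL a → entry01Q (f g) = x₀ * a := by
    intro g a hg
    by_cases ha : a = 0
    · have : g = 1 := hinj (by rw [hg, ha, unipotentGL_zero, map_one])
      rw [this, hf1, map_zero, ha, mul_zero]
    · obtain ⟨j, hj⟩ := htrans g a ha hg
      have hgj : g = d ^ j * g₀ * (d ^ j)⁻¹ :=
        hinj (by rw [hg, map_pow_conj_eq_unipotentGL hd hg₀ j, hj])
      rw [hgj, hypow, hj, hx₀]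
      field_simp
  -- the coboundary of `x₀ E₀₀`
  set X : W₂ := Submodule.Quotient.mk (x₀ • !![1, 0; 0, 0] : M₂) with hX
  have hXδ : diagDiffQ X = x₀ := by simp [hX]
  have hX01 : entry01Q X = 0 := by simp [hX]
  have hX10 : entry10Q X = 0 := by simp [hX]
  have hU : ∀ g ∈ unipSubgroup τ, f g = adz τ g X - X := by
    rintro g ⟨a, hg⟩
    obtain ⟨h1, h2, h3⟩ := forms_adz_of_unipotentGL hg X
    refine quot_eq_of_forms ?_ ?_ ?_
    · rw [hδ g ⟨a, hg⟩, map_sub, h1, sub_self]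
    · rw [hy g a hg, map_sub, h3, hXδ, hX01, hX10]; ring
    · rw [hz g a hg, map_sub, h2, sub_self]
  have hdX : adz τ d X = X := by rw [hX]; exact adz_diag_E00 hd01 hd10 x₀
  have hDX : ∀ x ∈ Subgroup.zpowers d, adz τ x X = X := by
    intro x hx
    rw [← mem_powers_iff_mem_zpowers] at hx
    obtain ⟨n, rfl⟩ := hx
    change adz τ (d ^ n) X = X
    induction n with
    | zero => rw [pow_zero, map_one, Module.End.one_apply]
    | succ n ih => rw [pow_succ, map_mul, Module.End.mul_apply, hdX, ih]
  have hD : ∀ x ∈ Subgroup.zpowers d, f x = adz τ x X - X := by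
    intro x hx
    rw [hfd x hx, hDX x hx, sub_self]
  -- the solution set of `f = ∂X` is a subgroup
  let Z : Subgroup G :=
    { carrier := {x | f x = adz τ x X - X}
      one_mem' := by
        simp only [Set.mem_setOf_eq]
        rw [hf1, map_one, Module.End.one_apply, sub_self]
      mul_mem' := by
        intro x y hx hy
        simp only [Set.mem_setOf_eq] at hx hy ⊢
        rw [hf, hx, hy, map_sub, map_mul, Module.End.mul_apply]
        abel
      inv_mem' := by
        intro x hx
        simp only [Set.mem_setOf_eq] at hx ⊢
        rw [MonomialAdequacy.cocycle_apply_inv _ f hf, hx, map_sub, ← Module.End.mul_apply,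
          ← map_mul, inv_mul_cancel, map_one, Module.End.one_apply]
        abel }
  have hle : unipSubgroup τ ⊔ Subgroup.zpowers d ≤ Z := sup_le hU hD
  exact ⟨X, fun x hx => hle hx⟩

/-- **Clause (ii) in normal form: `H¹(τ(G), ad/Z) = 0`.**  Restriction to `U ⊔ ⟨d⟩`, which
contains the Sylow `2`-subgroup `U` and so has odd index, reflects coboundaries; on `⟨d⟩` (odd
order) a cocycle is a coboundary, and after this normalisation `exists_eq_sub_sup_zpowers` applies.
[folklore] -/
theorem cocycles₁_le_coboundaries₁_of_normalForm (hinj : Function.Injective τ) {a₀ : K}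
    (ha₀ : a₀ ≠ 0) {g₀ : G} (hg₀ : τ g₀ = unipotentGL a₀) {d : G}
    (hd01 : ((τ d : GL (Fin 2) K) : M₂) 0 1 = 0) (hd10 : ((τ d : GL (Fin 2) K) : M₂) 1 0 = 0)
    (hr : ratio τ d ≠ 1)
    (htrans : ∀ (g : G) (a : K), a ≠ 0 → τ g = unipotentGL a → ∃ j : ℕ, a = ratio τ d ^ j * a₀) :
    groupCohomology.cocycles₁ (Rep.of (Subgroup.adModScalarRep τ.range)) ≤
      groupCohomology.coboundaries₁ (Rep.of (Subgroup.adModScalarRep τ.range)) := by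
  classical
  rw [cocycles₁_le_coboundaries₁_iff_forall]
  intro f hf
  change ∀ g h : τ.range, f (g * h) = Subgroup.adModScalarRep τ.range g (f h) + f g at hf
  change ∃ m, ∀ g : τ.range, f g = Subgroup.adModScalarRep τ.range g m - m
  -- pull back to `G`
  let e : G ≃* τ.range := MonoidHom.ofInjective hinj
  let fG : G → W₂ := fun g => f (e g)
  have hfG : ∀ g h : G, fG (g * h) = adz τ g (fG h) + fG g := fun g h => by
    show f (e (g * h)) = _
    rw [map_mul]
    exact hf _ _
  suffices h : ∃ m, ∀ g : G, fG g = adz τ g m - m by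
    obtain ⟨m, hm⟩ := h
    refine ⟨m, fun x => ?_⟩
    obtain ⟨g, rfl⟩ := e.surjective x
    exact hm g
  -- restriction to `B₀ = U ⊔ ⟨d⟩`, of odd index
  set B₀ : Subgroup G := unipSubgroup τ ⊔ Subgroup.zpowers d with hB₀
  have hidx : ((B₀.index : ℕ) : K) ≠ 0 := by
    intro h0
    rw [CharP.cast_eq_zero_iff K 2] at h0
    apply (unipSylow hinj ha₀ hg₀).not_dvd_index
    show 2 ∣ (unipSubgroup τ).index
    rw [← Subgroup.relIndex_mul_index (le_sup_left : unipSubgroup τ ≤ B₀)]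
    exact h0.mul_left _
  refine MonomialAdequacy.exists_eq_sub_of_subgroup (adz τ) B₀ hidx fG hfG ?_
  -- normalise on `⟨d⟩`, of odd order
  set D : Subgroup G := Subgroup.zpowers d with hDdef
  have hidxD : (((⊥ : Subgroup D).index : ℕ) : K) ≠ 0 := by
    intro h0
    rw [Subgroup.index_bot, hDdef, Nat.card_zpowers, CharP.cast_eq_zero_iff K 2] at h0
    exact (odd_orderOf_of_diag hinj hd01 hd10).not_two_dvd_nat h0
  obtain ⟨m₀, hm₀⟩ : ∃ m₀ : W₂, ∀ x : D, fG x = adz τ x m₀ - m₀ := by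
    obtain ⟨m₀, hm₀⟩ := MonomialAdequacy.exists_eq_sub_of_subgroup ((adz τ).comp D.subtype) ⊥ hidxD
      (fun x : D => fG x) (fun x y => hfG x y) ⟨0, fun x hx => by
        rw [Subgroup.mem_bot] at hx
        subst hx
        rw [map_one, Module.End.one_apply, sub_self]
        exact MonomialAdequacy.cocycle_apply_one _ fG hfG⟩
    exact ⟨m₀, fun x => hm₀ x⟩
  set f' : G → W₂ := fun g => fG g - (adz τ g m₀ - m₀) with hf'def
  have hf' : ∀ g h, f' (g * h) = adz τ g (f' h) + f' g := by
    intro g h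
    simp only [hf'def, hfG g h, map_mul, Module.End.mul_apply, map_sub]
    abel
  have hf'D : ∀ x ∈ D, f' x = 0 := fun x hx => by
    simp only [hf'def, hm₀ ⟨x, hx⟩, sub_self]
  obtain ⟨m₁, hm₁⟩ := exists_eq_sub_sup_zpowers hinj ha₀ hg₀ hd01 hd10 hr htrans f' hf' hf'D
  refine ⟨m₁ + m₀, fun x hx => ?_⟩
  have h := hm₁ x hx
  simp only [hf'def] at h
  rw [map_add, ← sub_add_cancel (fG x) (adz τ x m₀ - m₀), h]
  abel

end Cohomology

/-! ### Assembly of the normal form, and conjugation -/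

section Assembly

variable {G : Type*} [Group G] [Finite G] [CharP K 2]

/-- **Adequacy in normal form.**  `τ : G → GL₂(K)` injective without common eigenvector, with
`τ g₀ = u_{a₀}`, `τ g₁ = u_{a₁}` (`a₀, a₁ ≠ 0` distinct) and a diagonal `τ d` whose ratio generates
the parameters (`a = ratio(d)^j a₀` for every `u_a ∈ τ(G)`, `a ≠ 0`): then `τ(G)` is adequate in
the extended sense.
[cite: GuralnickHerzigTiep2017, Theorem 6.15 (the case `p = 2`); Corollary 9.4 (b)] -/
theorem isExtendedAdequate_range_of_normalForm {τ : G →* GL (Fin 2) K}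
    (hinj : Function.Injective τ) (hirr : ¬ HasCommonEigenvector τ) {a₀ : K} (ha₀ : a₀ ≠ 0)
    {g₀ : G} (hg₀ : τ g₀ = unipotentGL a₀) {g₁ : G} {a₁ : K} (ha₁ : a₁ ≠ 0) (ha₁₀ : a₁ ≠ a₀)
    (hg₁ : τ g₁ = unipotentGL a₁) {d : G} (hd01 : ((τ d : GL (Fin 2) K) : M₂) 0 1 = 0)
    (hd10 : ((τ d : GL (Fin 2) K) : M₂) 1 0 = 0)
    (htrans : ∀ (g : G) (a : K), a ≠ 0 → τ g = unipotentGL a → ∃ j : ℕ, a = ratio τ d ^ j * a₀) :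
    Subgroup.IsExtendedAdequate τ.range :=
  have hr : ratio τ d ≠ 1 := ratio_ne_one htrans ha₁ ha₁₀ hg₁
  ⟨addMonoidHom_eq_zero_of_normalForm hinj ha₀ hg₀ ((mem_upperSubgroup_iff τ).2 hd10) hr,
    cocycles₁_le_coboundaries₁_of_normalForm hinj ha₀ hg₀ hd01 hd10 hr htrans,
    semisimpleSpan_eq_top_of_normalForm hinj hirr ha₀ hg₀ ha₁ ha₁₀ hg₁⟩

end Assembly

end DegreeTwoAdequacy

/-! ### Extended adequacy is invariant under conjugation of the representation -/

section ConjInvariance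

variable {k : Type*} [Field k] {G : Type*} [Group G] {n : ℕ}

/-- **Adequacy of the image is invariant under conjugation**: if the image of `g ↦ P ρ(g) P⁻¹` is
adequate in the extended sense, so is the image of `ρ` (the three clauses are transported along
`x ↦ P x P⁻¹` and `M ↦ P M P⁻¹`). [folklore] -/
theorem isExtendedAdequate_range_of_conjGL (P : GL (Fin n) k) (ρ : G →* GL (Fin n) k)
    (h : Subgroup.IsExtendedAdequate (conjGL P ρ).range) :
    Subgroup.IsExtendedAdequate ρ.range := by
  classical
  have hmap : (conjGL P ρ).range = ρ.range.map ((MulAut.conj P : MulAut (GL (Fin n) k)) :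
      GL (Fin n) k →* GL (Fin n) k) := by
    rw [conjGL, MonoidHom.range_comp]
    rfl
  let e : ρ.range ≃* (conjGL P ρ).range :=
    ((MulAut.conj P).subgroupMap ρ.range).trans (MulEquiv.subgroupCongr hmap.symm)
  have he : ∀ x : ρ.range, ((e x : (conjGL P ρ).range) : GL (Fin n) k) = P * x * P⁻¹ := fun x => rfl
  have hesymm : ∀ y : (conjGL P ρ).range, ((y : (conjGL P ρ).range) : GL (Fin n) k) =
      P * (e.symm y : ρ.range) * P⁻¹ := fun y => by
    conv_lhs => rw [← e.apply_symm_apply y]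
    exact he _
  let A := adModScalar (Fin n) k
  refine ⟨?_, ?_, ?_⟩
  · -- (i)
    intro F
    have h1 := h.addMonoidHom_eq_zero (F.comp (MonoidHom.toAdditive e.symm.toMonoidHom))
    refine AddMonoidHom.ext fun x => ?_
    have h2 := DFunLike.congr_fun h1 (Additive.ofMul (e (Additive.toMul x)))
    simp only [AddMonoidHom.coe_comp, Function.comp_apply, MonoidHom.toAdditive_apply_apply,
      toMul_ofMul, MulEquiv.coe_toMonoidHom, MulEquiv.symm_apply_apply,
      AddMonoidHom.zero_apply, ofMul_toMul] at h2
    rw [AddMonoidHom.zero_apply]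
    exact h2
  · -- (ii)
    rw [cocycles₁_le_coboundaries₁_iff_forall]
    intro f hf
    change ∀ g h' : ρ.range, f (g * h') = A (g : GL (Fin n) k) (f h') + f g at hf
    change ∃ m, ∀ g : ρ.range, f g = A (g : GL (Fin n) k) m - m
    let f' : (conjGL P ρ).range → Matrix (Fin n) (Fin n) k ⧸ scalarMatrices (Fin n) k :=
      fun y => A P (f (e.symm y))
    have hf' : ∀ g h', f' (g * h') = Subgroup.adModScalarRep (conjGL P ρ).range g (f' h') + f' g := by
      intro g h'
      change A P (f (e.symm (g * h'))) = A (g : GL (Fin n) k) (A P (f (e.symm h'))) + A P (f (e.symm g))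
      rw [map_mul, hf, map_add, ← Module.End.mul_apply, ← map_mul, ← Module.End.mul_apply (A _),
        ← map_mul, hesymm g, inv_mul_cancel_right]
    obtain ⟨m', hm'⟩ := h.exists_eq_sub_of_cocycle f' hf'
    refine ⟨A P⁻¹ m', fun x => ?_⟩
    have h2 := hm' (e x)
    change A P (f (e.symm (e x))) = A ((e x : (conjGL P ρ).range) : GL (Fin n) k) m' - m' at h2
    rw [e.symm_apply_apply, he] at h2
    have h3 := congrArg (A P⁻¹) h2
    rw [← Module.End.mul_apply, ← map_mul, inv_mul_cancel, map_one, Module.End.one_apply] at h3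
    rw [h3, map_sub, ← Module.End.mul_apply, ← map_mul, ← Module.End.mul_apply (A _) (A P⁻¹),
      ← map_mul]
    congr 2
    group
  · -- (iii)
    let c : Matrix (Fin n) (Fin n) k →ₗ[k] Matrix (Fin n) (Fin n) k :=
      (LinearMap.mulLeft k ((P⁻¹ : GL (Fin n) k) : Matrix (Fin n) (Fin n) k)).comp
        (LinearMap.mulRight k ((P : GL (Fin n) k) : Matrix (Fin n) (Fin n) k))
    have hc : ∀ M, c M = ((P⁻¹ : GL (Fin n) k) : Matrix (Fin n) (Fin n) k) * M *
        ((P : GL (Fin n) k) : Matrix (Fin n) (Fin n) k) := fun M => by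
      simp [c, Matrix.mul_assoc]
    have hle : (Subgroup.semisimpleSpan (conjGL P ρ).range).map c ≤
        Subgroup.semisimpleSpan ρ.range := by
      rw [Subgroup.semisimpleSpan_def, Submodule.map_span, Submodule.span_le]
      rintro _ ⟨M, ⟨y, hy, rfl⟩, rfl⟩
      refine Submodule.subset_span ⟨e.symm y, ?_, ?_⟩
      · have h1 : orderOf ((e.symm y : ρ.range) : GL (Fin n) k) = orderOf ((y : (conjGL P ρ).range) :
            GL (Fin n) k) := by
          rw [Subgroup.orderOf_coe, Subgroup.orderOf_coe, MulEquiv.orderOf_eq]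
        rwa [h1]
      · rw [hc, hesymm y]
        simp only [Units.val_mul]
        rw [← Matrix.mul_assoc, ← Matrix.mul_assoc, ← Units.val_mul, inv_mul_cancel, Units.val_one,
          Matrix.one_mul, Matrix.mul_assoc, ← Units.val_mul, inv_mul_cancel, Units.val_one,
          Matrix.mul_one]
    rw [eq_top_iff]
    rintro X -
    have hX : X = c (((P : GL (Fin n) k) : Matrix (Fin n) (Fin n) k) * X *
        ((P⁻¹ : GL (Fin n) k) : Matrix (Fin n) (Fin n) k)) := by
      rw [hc, ← Matrix.mul_assoc, ← Matrix.mul_assoc, ← Units.val_mul, inv_mul_cancel, Units.val_one,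
        Matrix.one_mul, Matrix.mul_assoc, ← Units.val_mul, inv_mul_cancel, Units.val_one,
        Matrix.mul_one]
    rw [hX]
    exact hle (Submodule.mem_map_of_mem (h.semisimpleSpan_eq_top ▸ Submodule.mem_top))

end ConjInvariance

namespace DegreeTwoAdequacy

variable {K : Type*} [Field K]

local notation "M₂" => Matrix (Fin 2) (Fin 2) K

section Diagonalise

variable {G : Type*} [Group G] [Finite G] [CharP K 2]

/-- **Diagonalising the generator.**  From the data of `exists_forall_eq_ratio_pow_mul` (an upper
triangular `d` whose ratio generates the parameters) and a second non-trivial parameter, conjugation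
by `Q = (1 β; 0 δ-α)` (`τ d = (α β; 0 δ)`, `α ≠ δ`) puts `τ` in normal form, whence adequacy.
[cite: GuralnickHerzigTiep2017, Theorem 6.15 (the case `p = 2`)] -/
theorem isExtendedAdequate_range_of_upper {τ : G →* GL (Fin 2) K} (hinj : Function.Injective τ)
    (hirr : ¬ HasCommonEigenvector τ) {a₀ : K} (ha₀ : a₀ ≠ 0) {g₀ : G}
    (hg₀ : τ g₀ = unipotentGL a₀) {g₁ : G} {a₁ : K} (ha₁ : a₁ ≠ 0) (ha₁₀ : a₁ ≠ a₀)
    (hg₁ : τ g₁ = unipotentGL a₁) {d : G} (hd : d ∈ upperSubgroup τ)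
    (htrans : ∀ (g : G) (a : K), a ≠ 0 → τ g = unipotentGL a → ∃ j : ℕ, a = ratio τ d ^ j * a₀) :
    Subgroup.IsExtendedAdequate τ.range := by
  have hr : ratio τ d ≠ 1 := ratio_ne_one htrans ha₁ ha₁₀ hg₁
  have hd10 : ((τ d : GL (Fin 2) K) : M₂) 1 0 = 0 := (mem_upperSubgroup_iff τ).1 hd
  obtain ⟨hα, hδ⟩ := entry_ne_zero_of_mem_upperSubgroup τ hd
  set α : K := ((τ d : GL (Fin 2) K) : M₂) 0 0 with hαdef
  set β : K := ((τ d : GL (Fin 2) K) : M₂) 0 1 with hβdef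
  set δ : K := ((τ d : GL (Fin 2) K) : M₂) 1 1 with hδdef
  have hαδ : δ - α ≠ 0 := by
    intro h0
    apply hr
    rw [ratio, ← hαdef, ← hδdef, sub_eq_zero.1 h0, div_self hα]
  -- the conjugating matrix
  let Q : GL (Fin 2) K := Matrix.GeneralLinearGroup.mkOfDetNeZero !![1, β; 0, δ - α]
    (by rw [Matrix.det_fin_two_of]; simpa using hαδ)
  have hQ : ((Q : GL (Fin 2) K) : M₂) = !![1, β; 0, δ - α] := rfl
  have hQ10 : ((Q : GL (Fin 2) K) : M₂) 1 0 = 0 := by rw [hQ]; simp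
  have hQratio : ((Q : GL (Fin 2) K) : M₂) 0 0 / ((Q : GL (Fin 2) K) : M₂) 1 1 = (δ - α)⁻¹ := by
    rw [hQ]; simp
  let τ₂ : G →* GL (Fin 2) K := conjGL Q⁻¹ τ
  have hτ₂ : ∀ g, τ₂ g = Q⁻¹ * τ g * Q := fun g => by
    show conjGL Q⁻¹ τ g = _; rw [conjGL_apply, inv_inv]
  -- unipotent elements
  have hunip : ∀ {g : G} {a : K}, τ g = unipotentGL a → τ₂ g = unipotentGL ((δ - α) * a) := by
    intro g a hg
    have h1 := conj_unipotentGL_of_upper hQ10 ((δ - α) * a)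
    rw [hQratio, ← mul_assoc, inv_mul_cancel₀ hαδ, one_mul] at h1
    rw [hτ₂, hg, ← h1]
    group
  have hunip' : ∀ {g : G} {b : K}, τ₂ g = unipotentGL b → τ g = unipotentGL ((δ - α)⁻¹ * b) := by
    intro g b hg
    rw [hτ₂] at hg
    have h1 : τ g = Q * unipotentGL b * Q⁻¹ := by rw [← hg]; group
    rw [h1, conj_unipotentGL_of_upper hQ10, hQratio]
  -- the diagonalised generator
  have hQd : ((τ d : GL (Fin 2) K) : M₂) * (Q : M₂) = (Q : M₂) * !![α, 0; 0, δ] := by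
    rw [hQ, Matrix.eta_fin_two ((τ d : GL (Fin 2) K) : M₂), ← hαdef, ← hβdef, ← hδdef, hd10]
    ext i j
    fin_cases i <;> fin_cases j <;> simp [Matrix.mul_apply, Fin.sum_univ_two] <;> ring
  have hτ₂d : ((τ₂ d : GL (Fin 2) K) : M₂) = !![α, 0; 0, δ] := by
    rw [hτ₂, Units.val_mul, Units.val_mul, Matrix.mul_assoc, hQd, ← Matrix.mul_assoc,
      ← Units.val_mul, inv_mul_cancel, Units.val_one, Matrix.one_mul]
  have hd01' : ((τ₂ d : GL (Fin 2) K) : M₂) 0 1 = 0 := by rw [hτ₂d]; simp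
  have hd10' : ((τ₂ d : GL (Fin 2) K) : M₂) 1 0 = 0 := by rw [hτ₂d]; simp
  have hratio : ratio τ₂ d = ratio τ d := by
    rw [ratio, ratio, hτ₂d, ← hαdef, ← hδdef]; simp
  -- the normal form hypotheses for `τ₂`
  have hinj₂ : Function.Injective τ₂ := (MulAut.conj Q⁻¹).injective.comp hinj
  have hirr₂ : ¬ HasCommonEigenvector τ₂ := fun h => hirr (HasCommonEigenvector.of_conjGL h)
  have htrans₂ : ∀ (g : G) (b : K), b ≠ 0 → τ₂ g = unipotentGL b →
      ∃ j : ℕ, b = ratio τ₂ d ^ j * ((δ - α) * a₀) := by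
    intro g b hb hg
    obtain ⟨j, hj⟩ := htrans g _ (mul_ne_zero (inv_ne_zero hαδ) hb) (hunip' hg)
    refine ⟨j, ?_⟩
    rw [hratio]
    have := congrArg (fun x => (δ - α) * x) hj
    simp only [← mul_assoc, mul_inv_cancel₀ hαδ, one_mul] at this
    rw [this]; ring
  have h₂ := isExtendedAdequate_range_of_normalForm hinj₂ hirr₂ (mul_ne_zero hαδ ha₀) (hunip hg₀)
    (mul_ne_zero hαδ ha₁) (fun h => ha₁₀ (mul_left_cancel₀ hαδ h)) (hunip hg₁) hd01' hd10' htrans₂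
  exact isExtendedAdequate_range_of_conjGL Q⁻¹ τ h₂

/-- **The `2`-Sylow branch point.**  `τ` injective without common eigenvector and some
`τ g₀ = u_{a₀}`, `a₀ ≠ 0`: either `u_{a₀}` is the only non-trivial upper unipotent element of
`τ(G)` (then `G` has a normal subgroup of odd order and index `2`), or `τ(G)` is adequate.
[cite: GuralnickHerzigTiep2017, Theorem 6.15 (the case `p = 2`), Proposition 6.5] -/
theorem isExtendedAdequate_range_or_exists_normal {τ : G →* GL (Fin 2) K}
    (hinj : Function.Injective τ) (hirr : ¬ HasCommonEigenvector τ) {a₀ : K} (ha₀ : a₀ ≠ 0)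
    {g₀ : G} (hg₀ : τ g₀ = unipotentGL a₀) :
    Subgroup.IsExtendedAdequate τ.range ∨
      ∃ M : Subgroup G, M.Normal ∧ ¬ 2 ∣ Nat.card M ∧ M.index = 2 := by
  by_cases hq : ∀ (g : G) (a : K), τ g = unipotentGL a → a = 0 ∨ a = a₀
  · exact Or.inr (exists_normal_odd_index_two hinj ha₀ hg₀ hq)
  · push Not at hq
    obtain ⟨g₁, a₁, hg₁, ha₁, ha₁₀⟩ := hq
    obtain ⟨d, hd, htrans⟩ := exists_forall_eq_ratio_pow_mul hinj hirr ha₀ hg₀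
    exact Or.inl (isExtendedAdequate_range_of_upper hinj hirr ha₀ hg₀ ha₁ ha₁₀ hg₁ hd htrans)

end Diagonalise

/-! ### The case `q = 2`: a normal subgroup of odd order and index `2` gives two permuted lines -/

section OddNormal

variable {G : Type*} [Group G]

/-- `det (X - λ) = det X - λ tr X + λ²` for `2 × 2` matrices. [folklore] -/
theorem det_sub_smul_one (X : M₂) (l : K) :
    (X - l • (1 : M₂)).det = X.det - l * X.trace + l * l := by
  simp [Matrix.det_fin_two, Matrix.trace_fin_two]
  ring

/-- An invertible matrix kills no non-zero vector. [folklore] -/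
theorem eq_zero_of_mulVec_eq_zero (A : GL (Fin 2) K) {v : Fin 2 → K} (h : (A : M₂) *ᵥ v = 0) :
    v = 0 := by
  have := congrArg (fun w => ((A⁻¹ : GL (Fin 2) K) : M₂) *ᵥ w) h
  simpa only [Matrix.mulVec_mulVec, ← Units.val_mul, inv_mul_cancel, Units.val_one,
    Matrix.one_mulVec, Matrix.mulVec_zero] using this

/-- The eigenvalue of an invertible matrix on a non-zero eigenvector is non-zero. [folklore] -/
theorem ne_zero_of_mulVec_eq_smul (A : GL (Fin 2) K) {v : Fin 2 → K} (hv : v ≠ 0) {c : K}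
    (h : (A : M₂) *ᵥ v = c • v) : c ≠ 0 := by
  rintro rfl
  rw [zero_smul] at h
  exact hv (eq_zero_of_mulVec_eq_zero A h)

/-- **A matrix acting by the same scalar on two independent vectors of `K²` is scalar.**
[folklore] -/
theorem eq_smul_one_of_mulVec_eq_smul {X : M₂} {v w : Fin 2 → K} {μ : K} (hv : v ≠ 0)
    (hw : ∀ c : K, w ≠ c • v) (h1 : X *ᵥ v = μ • v) (h2 : X *ᵥ w = μ • w) :
    X = μ • (1 : M₂) := by
  set Pm : M₂ := !![v 0, w 0; v 1, w 1] with hPm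
  have hdet : Pm.det ≠ 0 := by
    intro h0
    rw [hPm, Matrix.det_fin_two_of] at h0
    by_cases hv0 : v 0 = 0
    · have hv1 : v 1 ≠ 0 := by
        intro hv1; apply hv; ext i; fin_cases i <;> simp [hv0, hv1]
      rw [hv0, zero_mul, zero_sub, neg_eq_zero] at h0
      have hw0 : w 0 = 0 := (mul_eq_zero.1 h0).resolve_right hv1
      apply hw (w 1 / v 1)
      ext i; fin_cases i
      · simp [hw0, hv0]
      · simp [div_mul_cancel₀ _ hv1]
    · apply hw (w 0 / v 0)
      ext i; fin_cases i
      · simp [div_mul_cancel₀ _ hv0]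
      · simp only [Fin.mk_one, Fin.isValue, Pi.smul_apply, smul_eq_mul]
        rw [div_mul_eq_mul_div, eq_div_iff hv0]
        linear_combination h0
  have c0 := fun i => congrFun h1 i
  have c1 := fun i => congrFun h2 i
  simp only [Matrix.mulVec, dotProduct, Fin.sum_univ_two, Pi.smul_apply, smul_eq_mul] at c0 c1
  have hXP : X * Pm = μ • Pm := by
    ext i j
    fin_cases i <;> fin_cases j <;> simp [Matrix.mul_apply, Fin.sum_univ_two, hPm, c0, c1]
  have h3 : X = X * Pm * Pm⁻¹ := by
    rw [Matrix.mul_assoc, Matrix.mul_nonsing_inv _ (isUnit_iff_ne_zero.2 hdet), Matrix.mul_one]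
  rw [h3, hXP, Matrix.smul_mul, Matrix.mul_nonsing_inv _ (isUnit_iff_ne_zero.2 hdet)]

/-- **An eigenvector of a diagonal matrix with distinct eigenvalues lies on one of the two axes.**
[folklore] -/
theorem exists_eq_smul_basis_of_mulVec_eq (b : Module.Basis (Fin 2) K (Fin 2 → K)) {X : M₂}
    {d : Fin 2 → K} (hd : d 0 ≠ d 1) (hX : ∀ i, X *ᵥ b i = d i • b i) {w : Fin 2 → K} {μ : K}
    (hw : X *ᵥ w = μ • w) : ∃ (j : Fin 2) (c : K), w = c • b j := by
  have hw' : w = b.repr w 0 • b 0 + b.repr w 1 • b 1 := by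
    conv_lhs => rw [← b.sum_repr w]
    rw [Fin.sum_univ_two]
  have h := hw
  rw [hw', Matrix.mulVec_add, Matrix.mulVec_smul, Matrix.mulVec_smul, hX 0, hX 1, smul_add] at h
  have k0 := congrArg (fun u => b.repr u 0) h
  have k1 := congrArg (fun u => b.repr u 1) h
  simp only [map_add, map_smul, Module.Basis.repr_self, Finsupp.smul_single, Finsupp.coe_add,
    Pi.add_apply, Finsupp.single_apply, smul_eq_mul, mul_one] at k0 k1
  simp at k0 k1
  by_cases hr0 : b.repr w 0 = 0
  · refine ⟨1, b.repr w 1, ?_⟩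
    rw [hr0, zero_smul, zero_add] at hw'
    exact hw'
  · have hμ : d 0 = μ := by
      have : b.repr w 0 * (d 0 - μ) = 0 := by linear_combination k0
      exact sub_eq_zero.1 ((mul_eq_zero.1 this).resolve_left hr0)
    have hr1 : b.repr w 1 = 0 := by
      have : b.repr w 1 * (d 1 - d 0) = 0 := by rw [hμ]; linear_combination k1
      exact (mul_eq_zero.1 this).resolve_right (sub_ne_zero.2 (Ne.symm hd))
    refine ⟨0, b.repr w 0, ?_⟩
    rw [hr1, zero_smul, add_zero] at hw'
    exact hw'

/-- **An element of odd order whose eigenvalue at an eigenvector squares to the determinant is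
scalar** (`char K = 2`): `x = μ(1 + N)` with `N² = 0`, and `x^k = 1` with `k` odd forces `N = 0`.
[folklore] -/
theorem coe_eq_smul_one_of_odd [CharP K 2] {x : GL (Fin 2) K} (hodd : Odd (orderOf x))
    {v : Fin 2 → K} (hv : v ≠ 0) {μ : K} (hxv : (x : M₂) *ᵥ v = μ • v)
    (hdet : (x : M₂).det = μ * μ) : (x : M₂) = μ • 1 := by
  have hμ : μ ≠ 0 := ne_zero_of_mulVec_eq_smul x hv hxv
  have hroot : ((x : M₂) - μ • 1).det = 0 := by
    rw [← Matrix.exists_mulVec_eq_zero_iff]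
    exact ⟨v, hv, by rw [Matrix.sub_mulVec, Matrix.smul_mulVec, Matrix.one_mulVec, hxv, sub_self]⟩
  rw [det_sub_smul_one, hdet] at hroot
  have htr : (x : M₂).trace = μ + μ := by
    have : μ * ((μ + μ) - (x : M₂).trace) = 0 := by linear_combination hroot
    linear_combination -(mul_eq_zero.1 this).resolve_left hμ
  set N : M₂ := (x : M₂) - μ • 1 with hN
  have hNN : N * N = 0 := GL2.sub_mul_sub_eq_zero (x : M₂) htr.symm hdet.symm
  have hx : (x : M₂) = μ • 1 + N := by rw [hN]; abel
  set k := orderOf x with hk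
  have hk0 : (k : K) ≠ 0 := by
    intro h0
    rw [CharP.cast_eq_zero_iff K 2] at h0
    exact hodd.not_two_dvd_nat h0
  have hpow : (μ ^ k) • (1 : M₂) + ((k : K) * μ ^ (k - 1)) • N = 1 := by
    rw [← GL2.smul_one_add_pow_of_mul_self_eq_zero N hNN μ k, ← hx, ← Units.val_pow_eq_pow_val, hk,
      pow_orderOf_eq_one, Units.val_one]
  -- multiply by `N`: `μ^k N = N`
  have hN1 : (μ ^ k) • N = N := by
    have := congrArg (· * N) hpow
    simpa only [add_mul, smul_mul_assoc, one_mul, hNN, smul_zero, add_zero] using this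
  have hN0 : N = 0 := by
    by_cases hμk : μ ^ k = 1
    · rw [hμk, one_smul, add_eq_left, smul_eq_zero] at hpow
      exact hpow.resolve_left (mul_ne_zero hk0 (pow_ne_zero _ hμ))
    · have : (μ ^ k - 1) • N = 0 := by rw [sub_smul, one_smul, hN1, sub_self]
      exact (smul_eq_zero.1 this).resolve_left (sub_ne_zero.2 hμk)
  rw [hx, hN0, add_zero]

variable [Finite G] [CharP K 2]

/-- **The case `q = 2` of the dichotomy.**  If `τ` is injective and irreducible over an
algebraically closed field of characteristic `2` and `G` has a normal subgroup `M` of odd order and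
index `2`, then `τ(G)` permutes two lines with a non-central kernel: averaging `E₀₀` over `M` gives
a non-scalar matrix commuting with `τ(M)`, whence an `M`-stable line `K v₀`; `τ(M)` consists of
semisimple commuting elements, so it is diagonal in a basis `(v₀, v₁)`, and `G` permutes the two
eigenlines of a non-scalar `τ(m₀)`, `m₀ ∈ M`.
[cite: GuralnickHerzigTiep2017, Proposition 6.5 (i) (the case `p = 2`)] -/
theorem exists_lines_of_normal_odd [IsAlgClosed K] {τ : G →* GL (Fin 2) K}
    (hinj : Function.Injective τ) (hirr : (glRepresentation τ).IsIrreducible) {M : Subgroup G}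
    [hMn : M.Normal] (hModd : ¬ 2 ∣ Nat.card M) (hMi : M.index = 2) :
    ∃ (b : Module.Basis (Fin 2) K (Fin 2 → K)) (θ : ↥τ.range →* Equiv.Perm (Fin 2)),
      (∀ (h : τ.range) (i : Fin 2), ∃ c : K, ((h : GL (Fin 2) K) : M₂) *ᵥ b i = c • b (θ h i)) ∧
      ¬ θ.ker ≤ Subgroup.center τ.range := by
  classical
  have hirr' : ¬ HasCommonEigenvector τ := not_hasCommonEigenvector_of_isIrreducible τ hirr
  haveI : Fintype M := Fintype.ofFinite M
  have hModd' : ∀ m : M, Odd (orderOf (τ (m : G))) := fun m => by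
    rw [orderOf_injective τ hinj, Subgroup.orderOf_coe, ← Nat.not_even_iff_odd, even_iff_two_dvd]
    exact fun h => hModd (h.trans (orderOf_dvd_natCard m))
  have hcard : ((Nat.card M : ℕ) : K) ≠ 0 := fun h0 => hModd ((CharP.cast_eq_zero_iff K 2 _).1 h0)
  -- (1) the averaged matrix `Xb = Σ_m τ(m) E₀₀ τ(m)⁻¹`
  set E : M₂ := !![1, 0; 0, 0] with hE
  set Xb : M₂ := ∑ m : M, ((τ (m : G) : GL (Fin 2) K) : M₂) * E *
    (((τ (m : G))⁻¹ : GL (Fin 2) K) : M₂) with hXb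
  have hXinv : ∀ m₁ : M, ((τ (m₁ : G) : GL (Fin 2) K) : M₂) * Xb *
      (((τ (m₁ : G))⁻¹ : GL (Fin 2) K) : M₂) = Xb := by
    intro m₁
    simp only [hXb, Finset.mul_sum, Finset.sum_mul]
    refine Fintype.sum_equiv (Equiv.mulLeft m₁) _ _ (fun m => ?_)
    simp only [Equiv.coe_mulLeft, Subgroup.coe_mul, map_mul, mul_inv_rev, Units.val_mul,
      Matrix.mul_assoc]
  have htrXb : Xb.trace = (Nat.card M : K) := by
    rw [hXb, Matrix.trace_sum]
    have h1 : ∀ m : M, (((τ (m : G) : GL (Fin 2) K) : M₂) * E *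
        (((τ (m : G))⁻¹ : GL (Fin 2) K) : M₂)).trace = 1 := by
      intro m
      rw [Matrix.trace_mul_cycle, ← Units.val_mul, inv_mul_cancel, Units.val_one, Matrix.one_mul, hE,
        Matrix.trace_fin_two]
      simp
    rw [Finset.sum_congr rfl fun m _ => h1 m, Finset.sum_const, Finset.card_univ, nsmul_eq_mul,
      mul_one, Nat.card_eq_fintype_card]
  have hXns : ∀ c : K, Xb ≠ c • (1 : M₂) := by
    intro c hc
    apply hcard
    rw [← htrXb, hc, Matrix.trace_smul, Matrix.trace_one, Fintype.card_fin, smul_eq_mul,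
      show ((2 : ℕ) : K) = 0 by rw [Nat.cast_ofNat]; exact CharTwo.two_eq_zero, mul_zero]
  -- (2) an eigenvector `v₀` of `Xb`; `K v₀` is `M`-stable
  obtain ⟨μ, hμ⟩ := Module.End.exists_eigenvalue (Matrix.toLin' Xb)
  obtain ⟨v₀, hv₀⟩ := hμ.exists_hasEigenvector
  have hv₀0 : v₀ ≠ 0 := hv₀.2
  have hXv₀ : Xb *ᵥ v₀ = μ • v₀ := by
    have := hv₀.apply_eq_smul; rwa [Matrix.toLin'_apply] at this
  have hcommM : ∀ m : M, Xb * ((τ (m : G) : GL (Fin 2) K) : M₂) =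
      ((τ (m : G) : GL (Fin 2) K) : M₂) * Xb := by
    intro m
    conv_lhs => rw [← hXinv m]
    rw [Matrix.mul_assoc, ← Units.val_mul, inv_mul_cancel, Units.val_one, Matrix.mul_one]
  have hMv₀ : ∀ m : M, ∃ c : K, ((τ (m : G) : GL (Fin 2) K) : M₂) *ᵥ v₀ = c • v₀ := by
    intro m
    by_contra hne
    push Not at hne
    refine hXns μ (eq_smul_one_of_mulVec_eq_smul hv₀0 hne hXv₀ ?_)
    rw [Matrix.mulVec_mulVec, hcommM m, ← Matrix.mulVec_mulVec, hXv₀, Matrix.mulVec_smul]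
  -- (3) a non-scalar `τ m₀`, `m₀ ∈ M`
  obtain ⟨m₀, hm₀⟩ : ∃ m₀ : M, ∀ c : K, ((τ (m₀ : G) : GL (Fin 2) K) : M₂) ≠ c • 1 := by
    by_contra hall
    push Not at hall
    apply hirr'
    obtain ⟨g, hgM⟩ : ∃ g : G, g ∉ M := by
      by_contra hall'
      push Not at hall'
      have : M = ⊤ := eq_top_iff.2 fun g _ => hall' g
      rw [this, Subgroup.index_top] at hMi
      exact absurd hMi (by norm_num)
    obtain ⟨ν, hν⟩ := Module.End.exists_eigenvalue (Matrix.toLin' ((τ g : GL (Fin 2) K) : M₂))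
    obtain ⟨v, hv⟩ := hν.exists_hasEigenvector
    have hgv : ((τ g : GL (Fin 2) K) : M₂) *ᵥ v = ν • v := by
      have := hv.apply_eq_smul; rwa [Matrix.toLin'_apply] at this
    refine ⟨v, hv.2, fun x => ?_⟩
    by_cases hx : x ∈ M
    · obtain ⟨c, hc⟩ := hall ⟨x, hx⟩
      exact ⟨c, by rw [show ((τ x : GL (Fin 2) K) : M₂) = c • 1 from hc, Matrix.smul_mulVec,
        Matrix.one_mulVec]⟩
    · have hm : g⁻¹ * x ∈ M := by
        rw [Subgroup.mul_mem_iff_of_index_two hMi, Subgroup.inv_mem_iff]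
        exact iff_of_false hgM hx
      obtain ⟨c, hc⟩ := hall ⟨g⁻¹ * x, hm⟩
      refine ⟨c * ν, ?_⟩
      have e : x = g * (g⁻¹ * x) := by group
      rw [e, map_mul, Units.val_mul, show ((τ (g⁻¹ * x) : GL (Fin 2) K) : M₂) = c • 1 from hc,
        ← Matrix.mulVec_mulVec, Matrix.smul_mulVec, Matrix.one_mulVec, Matrix.mulVec_smul, hgv,
        smul_smul]
  obtain ⟨X₀, hX₀⟩ : ∃ X₀ : M₂, ((τ (m₀ : G) : GL (Fin 2) K) : M₂) = X₀ := ⟨_, rfl⟩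
  have hX₀ns : ∀ c : K, X₀ ≠ c • 1 := by rw [← hX₀]; exact hm₀
  -- (4) the two eigenvalues `α₀ ≠ δ₀` of `X₀` and the eigenvectors `v₀`, `v₁`
  obtain ⟨α₀, hα₀⟩ := hMv₀ m₀
  rw [hX₀] at hα₀
  have hα₀0 : α₀ ≠ 0 := ne_zero_of_mulVec_eq_smul (τ (m₀ : G)) hv₀0 (by rw [hX₀]; exact hα₀)
  have hroot₀ : (X₀ - α₀ • 1).det = 0 := by
    rw [← Matrix.exists_mulVec_eq_zero_iff]
    exact ⟨v₀, hv₀0, by rw [Matrix.sub_mulVec, Matrix.smul_mulVec, Matrix.one_mulVec, hα₀, sub_self]⟩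
  rw [det_sub_smul_one] at hroot₀
  obtain ⟨δ₀, hδ₀⟩ : ∃ δ₀ : K, δ₀ = X₀.trace - α₀ := ⟨_, rfl⟩
  have hαδ : α₀ * δ₀ = X₀.det := by rw [hδ₀]; linear_combination -hroot₀
  have hne : α₀ ≠ δ₀ := by
    intro h
    apply hm₀ α₀
    exact coe_eq_smul_one_of_odd (hModd' m₀) hv₀0 (by rw [hX₀]; exact hα₀)
      (by rw [hX₀, ← hαδ, ← h])
  have hroot₁ : (X₀ - δ₀ • 1).det = 0 := by
    rw [det_sub_smul_one, ← hαδ, hδ₀]; ring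
  obtain ⟨v₁, hv₁0, hv₁⟩ := Matrix.exists_mulVec_eq_zero_iff.2 hroot₁
  have hX₀v₁ : X₀ *ᵥ v₁ = δ₀ • v₁ := by
    rw [Matrix.sub_mulVec, Matrix.smul_mulVec, Matrix.one_mulVec, sub_eq_zero] at hv₁
    exact hv₁
  have hv₁v₀ : ∀ c : K, v₁ ≠ c • v₀ := by
    intro c h
    apply hv₁0
    have h1 : (δ₀ - α₀) • v₁ = 0 := by
      rw [sub_smul, ← hX₀v₁, h, Matrix.mulVec_smul, hα₀, smul_smul, smul_smul, mul_comm, sub_self]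
    exact (smul_eq_zero.1 h1).resolve_left (sub_ne_zero.2 (Ne.symm hne))
  -- (5) the basis `b = (v₀, v₁)`
  have hli : LinearIndependent K ![v₀, v₁] := by
    refine LinearIndependent.pair_iff.2 fun s t hst => ?_
    by_cases ht : t = 0
    · rw [ht, zero_smul, add_zero] at hst
      exact ⟨(smul_eq_zero.1 hst).resolve_right hv₀0, ht⟩
    · exfalso
      apply hv₁v₀ (-(s / t))
      have h1 : t • v₁ = -(s • v₀) := eq_neg_of_add_eq_zero_right hst
      calc v₁ = t⁻¹ • (t • v₁) := by rw [smul_smul, inv_mul_cancel₀ ht, one_smul]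
        _ = -(s / t) • v₀ := by rw [h1, smul_neg, smul_smul, neg_smul, div_eq_inv_mul]
  let b : Module.Basis (Fin 2) K (Fin 2 → K) := basisOfLinearIndependentOfCardEqFinrank hli (by simp)
  have hb : ⇑b = ![v₀, v₁] := coe_basisOfLinearIndependentOfCardEqFinrank hli _
  have hb0 : b 0 = v₀ := by rw [hb]; rfl
  have hb1 : b 1 = v₁ := by rw [hb]; rfl
  -- (6) `τ(M)` commutes with `X₀` (commutators are `1`) and is diagonal in `b`
  have hMcomm : ∀ m : M, ((τ (m : G) : GL (Fin 2) K) : M₂) * X₀ =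
      X₀ * ((τ (m : G) : GL (Fin 2) K) : M₂) := by
    intro m
    obtain ⟨c, hc⟩ := hMv₀ m
    have hc0 : c ≠ 0 := ne_zero_of_mulVec_eq_smul _ hv₀0 hc
    have hinvv : ∀ {z : G} {c : K}, ((τ z : GL (Fin 2) K) : M₂) *ᵥ v₀ = c • v₀ → c ≠ 0 →
        (((τ z)⁻¹ : GL (Fin 2) K) : M₂) *ᵥ v₀ = c⁻¹ • v₀ := by
      intro z c hz hc0
      have := congrArg (fun w => c⁻¹ • ((((τ z)⁻¹ : GL (Fin 2) K) : M₂) *ᵥ w)) hz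
      simp only [Matrix.mulVec_mulVec, ← Units.val_mul, inv_mul_cancel, Units.val_one,
        Matrix.one_mulVec, Matrix.mulVec_smul, smul_smul, inv_mul_cancel₀ hc0, one_smul] at this
      exact this.symm
    set y : G := (m : G) * (m₀ : G) * (m : G)⁻¹ * (m₀ : G)⁻¹ with hy
    have hyM : y ∈ M :=
      M.mul_mem (M.mul_mem (M.mul_mem m.2 m₀.2) (M.inv_mem m.2)) (M.inv_mem m₀.2)
    have hyv : ((τ y : GL (Fin 2) K) : M₂) *ᵥ v₀ = (1 : K) • v₀ := by
      have e1 : (((τ (m₀ : G))⁻¹ : GL (Fin 2) K) : M₂) *ᵥ v₀ = α₀⁻¹ • v₀ :=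
        hinvv (by rw [hX₀]; exact hα₀) hα₀0
      have e2 : (((τ (m : G))⁻¹ : GL (Fin 2) K) : M₂) *ᵥ v₀ = c⁻¹ • v₀ := hinvv hc hc0
      rw [hy, map_mul, map_mul, map_mul, map_inv, map_inv, Units.val_mul, Units.val_mul,
        Units.val_mul, ← Matrix.mulVec_mulVec, ← Matrix.mulVec_mulVec, ← Matrix.mulVec_mulVec, e1]
      simp only [Matrix.mulVec_smul, e2, hX₀, hα₀, hc, smul_smul]
      congr 1
      field_simp
    have hydet : ((τ y : GL (Fin 2) K) : M₂).det = 1 * 1 := by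
      rw [mul_one, ← Matrix.GeneralLinearGroup.val_det_apply, hy, map_mul, map_mul, map_mul,
        map_inv, map_inv, map_mul, map_mul, map_mul, map_inv, map_inv, mul_inv_cancel_comm,
        mul_inv_cancel, Units.val_one]
    have hτy : ((τ y : GL (Fin 2) K) : M₂) = (1 : K) • 1 :=
      coe_eq_smul_one_of_odd (hModd' ⟨y, hyM⟩) hv₀0 hyv hydet
    have hy1 : y = 1 := hinj (by rw [map_one]; exact Units.ext (by rw [hτy, one_smul, Units.val_one]))
    rw [hy, mul_inv_eq_one, mul_inv_eq_iff_eq_mul] at hy1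
    have := congrArg (fun z : G => ((τ z : GL (Fin 2) K) : M₂)) hy1
    simpa only [map_mul, Units.val_mul, hX₀] using this
  have hMv₁ : ∀ m : M, ∃ c : K, ((τ (m : G) : GL (Fin 2) K) : M₂) *ᵥ v₁ = c • v₁ := by
    intro m
    by_contra hne'
    push Not at hne'
    refine hX₀ns δ₀ (eq_smul_one_of_mulVec_eq_smul hv₁0 hne' hX₀v₁ ?_)
    rw [Matrix.mulVec_mulVec, ← hMcomm m, ← Matrix.mulVec_mulVec, hX₀v₁, Matrix.mulVec_smul]
  have hdiagM : ∀ m : M, ∃ d : Fin 2 → K, ∀ i,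
      ((τ (m : G) : GL (Fin 2) K) : M₂) *ᵥ b i = d i • b i := by
    intro m
    obtain ⟨c₀, hc₀⟩ := hMv₀ m
    obtain ⟨c₁, hc₁⟩ := hMv₁ m
    refine ⟨![c₀, c₁], fun i => ?_⟩
    fin_cases i
    · simpa [hb0] using hc₀
    · simpa [hb1] using hc₁
  have hm₀d : ∀ i, X₀ *ᵥ b i = (![α₀, δ₀] : Fin 2 → K) i • b i := by
    intro i
    fin_cases i
    · simpa [hb0] using hα₀
    · simpa [hb1] using hX₀v₁
  have hαδ' : (![α₀, δ₀] : Fin 2 → K) 0 ≠ (![α₀, δ₀] : Fin 2 → K) 1 := by simpa using hne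
  -- (7) every `τ g` permutes the two lines (through the conjugate `g m₀ g⁻¹ ∈ M`)
  have hperm : ∀ (h : τ.range) (i : Fin 2), ∃ (j : Fin 2) (c : K),
      ((h : GL (Fin 2) K) : M₂) *ᵥ b i = c • b j := by
    rintro ⟨_, g, rfl⟩ i
    have hm₁M : g * m₀ * g⁻¹ ∈ M := hMn.conj_mem _ m₀.2 g
    obtain ⟨d, hd⟩ := hdiagM ⟨_, hm₁M⟩
    have hd01 : d 0 ≠ d 1 := by
      intro h01
      have hsc : ((τ (g * m₀ * g⁻¹) : GL (Fin 2) K) : M₂) = d 0 • 1 := by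
        refine eq_smul_one_of_mulVec_eq_smul (v := b 0) (w := b 1) (b.ne_zero 0) ?_ (hd 0) ?_
        · intro c hc
          apply hv₁v₀ c
          rw [← hb0, ← hb1]; exact hc
        · rw [h01]; exact hd 1
      apply hm₀ (d 0)
      have e : (m₀ : G) = g⁻¹ * (g * m₀ * g⁻¹) * g := by group
      rw [e, map_mul, map_mul, Units.val_mul, Units.val_mul, hsc, Matrix.mul_smul, Matrix.mul_one,
        Matrix.smul_mul, map_inv, ← Units.val_mul, inv_mul_cancel, Units.val_one]
    have heig : ((τ (g * m₀ * g⁻¹) : GL (Fin 2) K) : M₂) *ᵥ (((τ g : GL (Fin 2) K) : M₂) *ᵥ b i) =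
        (![α₀, δ₀] : Fin 2 → K) i • (((τ g : GL (Fin 2) K) : M₂) *ᵥ b i) := by
      rw [Matrix.mulVec_mulVec, ← Units.val_mul, ← map_mul,
        show g * ↑m₀ * g⁻¹ * g = g * ↑m₀ by group, map_mul, Units.val_mul, ← Matrix.mulVec_mulVec, hX₀,
        hm₀d i, Matrix.mulVec_smul]
    obtain ⟨j, c, hjc⟩ := exists_eq_smul_basis_of_mulVec_eq b hd01 hd heig
    exact ⟨j, c, hjc⟩
  obtain ⟨θ, hθ⟩ := MonomialAdequacy.exists_permHom_of_lines b hperm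
  refine ⟨b, θ, hθ, fun hle => ?_⟩
  -- (8) `τ m₀` lies in the kernel and is not central
  let x₀ : τ.range := ⟨τ (m₀ : G), m₀, rfl⟩
  have hθx₀ : θ x₀ = 1 := by
    refine Equiv.ext fun l => ?_
    obtain ⟨c, hc⟩ := hθ x₀ l
    have hc' : X₀ *ᵥ b l = c • b ((θ x₀) l) := by rw [← hX₀]; exact hc
    have hc0 : c ≠ 0 := by
      intro h0
      rw [h0, zero_smul, ← hX₀] at hc'
      exact b.ne_zero l (eq_zero_of_mulVec_eq_zero _ hc')
    have h1 : c • b (θ x₀ l) = (![α₀, δ₀] : Fin 2 → K) l • b l := by rw [← hc', hm₀d l]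
    exact MonomialAdequacy.basis_index_eq_of_smul_eq b h1 hc0
  have hcen := hle ((MonoidHom.mem_ker).2 hθx₀)
  rw [Subgroup.mem_center_iff] at hcen
  apply hirr'
  refine ⟨v₀, hv₀0, fun g => ?_⟩
  have hcomm : ((τ g : GL (Fin 2) K) : M₂) * X₀ = X₀ * ((τ g : GL (Fin 2) K) : M₂) := by
    have h := hcen ⟨τ g, g, rfl⟩
    have h' := congrArg (fun y : τ.range => ((y : GL (Fin 2) K) : M₂)) h
    change ((τ g : GL (Fin 2) K) : M₂) * ((τ (m₀ : G) : GL (Fin 2) K) : M₂) =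
      ((τ (m₀ : G) : GL (Fin 2) K) : M₂) * ((τ g : GL (Fin 2) K) : M₂) at h'
    rwa [hX₀] at h'
  have heig : X₀ *ᵥ (((τ g : GL (Fin 2) K) : M₂) *ᵥ v₀) = α₀ • (((τ g : GL (Fin 2) K) : M₂) *ᵥ v₀) := by
    rw [Matrix.mulVec_mulVec, ← hcomm, ← Matrix.mulVec_mulVec, hα₀, Matrix.mulVec_smul]
  obtain ⟨j, c, hjc⟩ := exists_eq_smul_basis_of_mulVec_eq b hαδ' hm₀d heig
  fin_cases j
  · simp only [Fin.zero_eta, Fin.isValue, hb0] at hjc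
    exact ⟨c, hjc⟩
  · exfalso
    simp only [Fin.mk_one, Fin.isValue, hb1] at hjc
    have h2 := heig
    rw [hjc, Matrix.mulVec_smul, hX₀v₁, smul_smul, smul_smul] at h2
    have h3 : (c * δ₀ - α₀ * c) • v₁ = 0 := by rw [sub_smul, h2, sub_self]
    have h4 : c * δ₀ - α₀ * c = 0 := (smul_eq_zero.1 h3).resolve_right hv₁0
    have hc0 : c = 0 := by
      have : c * (δ₀ - α₀) = 0 := by linear_combination h4
      exact (mul_eq_zero.1 this).resolve_right (sub_ne_zero.2 (Ne.symm hne))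
    rw [hc0, zero_smul] at hjc
    exact hv₀0 (eq_zero_of_mulVec_eq_zero _ hjc)


end OddNormal

/-! ### The dichotomy over an algebraically closed field of characteristic two -/

section Dichotomy

variable {G : Type*} [Group G] [Finite G] [CharP K 2]

omit [CharP K 2] in
/-- A vector `v ≠ 0` of `K²` is the first column of an invertible matrix. [folklore] -/
theorem exists_mulVec_single_eq {v : Fin 2 → K} (hv : v ≠ 0) :
    ∃ P : GL (Fin 2) K, ((P : GL (Fin 2) K) : M₂) *ᵥ (Pi.single 0 1 : Fin 2 → K) = v := by
  by_cases hv0 : v 0 = 0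
  · have hv1 : v 1 ≠ 0 := by
      intro h1; apply hv; ext i; fin_cases i <;> simp [hv0, h1]
    refine ⟨Matrix.GeneralLinearGroup.mkOfDetNeZero !![v 0, 1; v 1, 0]
      (by rw [Matrix.det_fin_two_of]; simpa using hv1), ?_⟩
    ext i
    fin_cases i <;>
      simp [Matrix.GeneralLinearGroup.mkOfDetNeZero, Matrix.mulVec, dotProduct, Fin.sum_univ_two]
  · refine ⟨Matrix.GeneralLinearGroup.mkOfDetNeZero !![v 0, 0; v 1, 1]
      (by rw [Matrix.det_fin_two_of]; simpa using hv0), ?_⟩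
    ext i
    fin_cases i <;>
      simp [Matrix.GeneralLinearGroup.mkOfDetNeZero, Matrix.mulVec, dotProduct, Fin.sum_univ_two]

/-- **The `p = 2` case of GHT Theorem 6.15, as a dichotomy (classification-free).**  Let `K` be
algebraically closed of characteristic `2`, `G` finite and `τ : G → GL₂(K)` faithful and
irreducible.  Then either `τ(G)` is adequate in the extended sense, or `τ(G)` permutes the two lines
of a basis with a kernel that is not central (the monomial case of Prop. 6.5 (i) / Prop. 6.6 with
`|G/A| = 2 = p`).  Proof: if `|G|` is odd, `τ(G)` is adequate (`p ∤ |G|`); otherwise an involution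
fixes a line, which we move to `K e₀`; by `isExtendedAdequate_range_or_exists_normal` either
`τ(G)` is adequate or `G` has a normal subgroup of odd order and index `2`, and then
`exists_lines_of_normal_odd` gives the two lines.
[cite: GuralnickHerzigTiep2017, Theorem 6.15 and Proposition 6.5 (the case `p = 2`)] -/
theorem isExtendedAdequate_range_or_exists_lines [IsAlgClosed K] {τ : G →* GL (Fin 2) K}
    (hinj : Function.Injective τ) (hirr : (glRepresentation τ).IsIrreducible) :
    Subgroup.IsExtendedAdequate τ.range ∨
      ∃ (b : Module.Basis (Fin 2) K (Fin 2 → K)) (θ : ↥τ.range →* Equiv.Perm (Fin 2)),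
        (∀ (h : τ.range) (i : Fin 2), ∃ c : K, ((h : GL (Fin 2) K) : M₂) *ᵥ b i = c • b (θ h i)) ∧
        ¬ θ.ker ≤ Subgroup.center τ.range := by
  classical
  have hirr' : ¬ HasCommonEigenvector τ := not_hasCommonEigenvector_of_isIrreducible τ hirr
  by_cases h2 : 2 ∣ Nat.card G
  · -- an involution and its fixed vector
    obtain ⟨g₁, hg₁⟩ := exists_prime_orderOf_dvd_card' 2 h2
    have hgg : g₁ * g₁ = 1 := by rw [← pow_two, ← hg₁, pow_orderOf_eq_one]
    have hg₁1 : g₁ ≠ 1 := by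
      intro h; rw [h, orderOf_one] at hg₁; exact absurd hg₁ (by norm_num)
    have hsq : τ g₁ * τ g₁ = 1 := by rw [← map_mul, hgg, map_one]
    have hN := sub_one_mul_self_eq_zero_of_mul_self_eq_one hsq
    have hN0 : ((τ g₁ : GL (Fin 2) K) : M₂) - 1 ≠ 0 := by
      intro h0
      have h1 : τ g₁ = 1 := Units.ext (sub_eq_zero.1 h0)
      exact hg₁1 (hinj (by rw [h1, map_one]))
    obtain ⟨v, hv, hNv⟩ := Serre1972.exists_ne_zero_mulVec_eq_zero hN0 hN
    rw [Matrix.sub_mulVec, Matrix.one_mulVec, sub_eq_zero] at hNv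
    -- move `v` to `e₀`
    obtain ⟨P, hP⟩ := exists_mulVec_single_eq hv
    let τ₁ : G →* GL (Fin 2) K := conjGL P⁻¹ τ
    have hτ₁ : ∀ g, τ₁ g = P⁻¹ * τ g * P := fun g => by
      show conjGL P⁻¹ τ g = _; rw [conjGL_apply, inv_inv]
    have hinj₁ : Function.Injective τ₁ := (MulAut.conj P⁻¹).injective.comp hinj
    have hirr₁ : ¬ HasCommonEigenvector τ₁ := fun h => hirr' (HasCommonEigenvector.of_conjGL h)
    have hsq₁ : τ₁ g₁ * τ₁ g₁ = 1 := by rw [← map_mul, hgg, map_one]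
    have hfix : ((τ₁ g₁ : GL (Fin 2) K) : M₂) *ᵥ (Pi.single 0 1 : Fin 2 → K) = Pi.single 0 1 := by
      rw [hτ₁, Units.val_mul, Units.val_mul, ← Matrix.mulVec_mulVec, ← Matrix.mulVec_mulVec, hP, hNv,
        ← hP, Matrix.mulVec_mulVec, ← Units.val_mul, inv_mul_cancel, Units.val_one, Matrix.one_mulVec]
    have h10 : ((τ₁ g₁ : GL (Fin 2) K) : M₂) 1 0 = 0 := by
      have := congrFun hfix 1
      simpa [Matrix.mulVec, dotProduct, Fin.sum_univ_two] using this
    have hg₀ := eq_unipotentGL_of_mul_self_eq_one hsq₁ h10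
    have ha₀ : ((τ₁ g₁ : GL (Fin 2) K) : M₂) 0 1 ≠ 0 := by
      intro h0
      rw [h0, unipotentGL_zero] at hg₀
      exact hg₁1 (hinj₁ (by rw [hg₀, map_one]))
    rcases isExtendedAdequate_range_or_exists_normal hinj₁ hirr₁ ha₀ hg₀ with had | ⟨M, hMn, hModd, hMi⟩
    · exact Or.inl (isExtendedAdequate_range_of_conjGL P⁻¹ τ had)
    · haveI := hMn
      exact Or.inr (exists_lines_of_normal_odd hinj hirr hModd hMi)
  · -- `|G|` odd
    left
    haveI : Representation.IsIrreducible ((glStdRepresentation (Fin 2) K).comp τ) := hirr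
    have hspan := Literature.RepresentationTheory.Semisimple.span_eq_top_of_isIrreducible τ
    exact isExtendedAdequate_range_of_not_dvd_card τ h2
      ((Literature.RepresentationTheory.Semisimple.span_eq_top_iff_forall_isIrreducible
        (by norm_num) τ).1 hspan)

end Dichotomy

end DegreeTwoAdequacy

/-! ### Theorem 1.7 for `p = 2`, and the sharpened reduction of the named fact -/

section Final

universe u v

/-- **What remains of Theorem 1.7: the primitive algebraically closed case for ODD `p`.**  The
hypothesis of `ght2017_adequate_or_index_p_or_psl29_of_primitive` (the part of Theorem 6.15 resting
on the classification of finite simple groups) is needed only for odd primes `p`: for `p = 2` it is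
PROVED by `DegreeTwoAdequacy.isExtendedAdequate_range_or_exists_lines` (a faithful irreducible
`τ : G → GL₂(K)`, `K = K̄` of characteristic `2`, without line structure of non-central kernel has
adequate image).
[cite: GuralnickHerzigTiep2017, Theorem 6.15 (proof, p. 24), Proposition 6.5, Corollary 9.4 (b)] -/
theorem ght2017_adequate_or_index_p_or_psl29_of_primitive_odd
    (hprim : ∀ (p : ℕ) [Fact p.Prime] (K : Type u) [Field K] [IsAlgClosed K] [CharP K p]
      (G : Type v) [Group G] [Finite G] (τ : G →* GL (Fin p) K),
      p ≠ 2 → Function.Injective τ → (glRepresentation τ).IsIrreducible →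
      (∀ (b : Module.Basis (Fin p) K (Fin p → K)) (θ : ↥τ.range →* Equiv.Perm (Fin p)),
        (∀ (h : τ.range) (i : Fin p), ∃ c : K,
          ((h : GL (Fin p) K) : Matrix (Fin p) (Fin p) K) *ᵥ b i = c • b (θ h i)) →
        θ.ker ≤ Subgroup.center τ.range) →
      Subgroup.IsExtendedAdequate τ.range ∨
        (∃ A : Subgroup G, A.Normal ∧ (∀ x ∈ A, ∀ y ∈ A, x * y = y * x) ∧ A.index = p) ∨
        (p = 3 ∧ Nonempty (↥(τ.range.map (QuotientGroup.mk' (Subgroup.center (GL (Fin p) K)))) ≃*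
          ↥(alternatingGroup (Fin 6))))) :
    ght2017_adequate_or_index_p_or_psl29.{u, v} := by
  refine ght2017_adequate_or_index_p_or_psl29_of_primitive
    fun p _ K _ _ _ G _ _ τ hinj hirr hmono => ?_
  by_cases hp : p = 2
  · subst hp
    left
    rcases DegreeTwoAdequacy.isExtendedAdequate_range_or_exists_lines hinj hirr with h | ⟨b, θ, hθ, hA⟩
    · exact h
    · exact absurd (hmono b θ hθ) hA
  · exact hprim p K G τ hp hinj hirr hmono

/-- **Guralnick–Herzig–Tiep 2017, Theorem 1.7 for `p = 2`, PROVED** (classification-free): for a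
field `k` of characteristic `2`, a finite group `G` and a faithful `σ : G → GL₂(k)` with `k²`
absolutely irreducible, either `σ(G)` is adequate in the extended sense or `G` has an abelian normal
subgroup of index `2` (alternative (c) of Theorem 1.7 needs `p = 3`).  Over `k̄` this is
`DegreeTwoAdequacy.isExtendedAdequate_range_or_exists_lines` (two permuted lines with kernel of
index `2` give the abelian normal subgroup; index `1` would contradict irreducibility); adequacy
descends to `k` by `Subgroup.IsExtendedAdequate.of_map`.
[cite: GuralnickHerzigTiep2017, Theorem 1.7 (the case `p = 2`), Theorem 6.15, Corollary 9.4 (b)] -/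
theorem ght2017_adequate_or_index_two (k : Type u) [Field k] [CharP k 2] (G : Type v) [Group G]
    [Finite G] (σ : G →* GL (Fin 2) k) (hinj : Function.Injective σ) (hirr : IsAbsIrreducible σ) :
    Subgroup.IsExtendedAdequate σ.range ∨
      ∃ A : Subgroup G, A.Normal ∧ (∀ x ∈ A, ∀ y ∈ A, x * y = y * x) ∧ A.index = 2 := by
  classical
  let K := AlgebraicClosure k
  let ι : k →+* K := algebraMap k K
  haveI : CharP K 2 := charP_of_injective_ringHom ι.injective 2
  let τ : G →* GL (Fin 2) K := (Matrix.GeneralLinearGroup.map ι).comp σ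
  have hτinj : Function.Injective τ := (glMap_injective_of_ringHom ι).comp hinj
  have hτirr : (glRepresentation τ).IsIrreducible := hirr K ι
  rcases DegreeTwoAdequacy.isExtendedAdequate_range_or_exists_lines hτinj hτirr with
    ha | ⟨b, θ, hθ, -⟩
  · refine Or.inl (Subgroup.IsExtendedAdequate.of_map ι σ.range ?_)
    rwa [MonoidHom.map_range]
  · right
    haveI : Finite τ.range := Finite.of_surjective _ τ.rangeRestrict_surjective
    -- the kernel has index `2` (index `1` would make `b 0` a common eigenvector)
    have hidx : θ.ker.index = 2 := by
      have hdvd : θ.ker.index ∣ 2 := by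
        rw [Subgroup.index_ker]
        have h := Subgroup.card_subgroup_dvd_card θ.range
        have h2 : Nat.card (Equiv.Perm (Fin 2)) = 2 := by
          rw [Nat.card_perm, Nat.card_eq_fintype_card, Fintype.card_fin, Nat.factorial_two]
        rwa [h2] at h
      rcases (Nat.dvd_prime Nat.prime_two).1 hdvd with h1 | h2
      · exfalso
        rw [Subgroup.index_eq_one] at h1
        apply not_hasCommonEigenvector_of_isIrreducible τ hτirr
        refine ⟨b 0, b.ne_zero 0, fun g => ?_⟩
        obtain ⟨c, hc⟩ := hθ ⟨τ g, g, rfl⟩ 0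
        have hk : θ ⟨τ g, g, rfl⟩ = 1 := (MonoidHom.mem_ker).1 (h1 ▸ Subgroup.mem_top _)
        rw [hk, Equiv.Perm.coe_one, id] at hc
        exact ⟨c, hc⟩
      · exact h2
    refine ⟨θ.ker.comap τ.rangeRestrict, inferInstance, ?_, ?_⟩
    · choose c hc using hθ
      intro x hx y hy
      apply hτinj
      have hx' : θ (τ.rangeRestrict x) = 1 := (MonoidHom.mem_ker).1 hx
      have hy' : θ (τ.rangeRestrict y) = 1 := (MonoidHom.mem_ker).1 hy
      have hdx := MonomialAdequacy.mulVec_basis_of_ker b θ c hc (τ.rangeRestrict x) hx'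
      have hdy := MonomialAdequacy.mulVec_basis_of_ker b θ c hc (τ.rangeRestrict y) hy'
      simp only [MonoidHom.coe_rangeRestrict] at hdx hdy
      rw [map_mul, map_mul]
      apply Units.ext
      rw [Units.val_mul, Units.val_mul]
      refine MonomialAdequacy.matrix_eq_of_mulVec_basis b fun i => ?_
      rw [← Matrix.mulVec_mulVec, ← Matrix.mulVec_mulVec, hdx, hdy, Matrix.mulVec_smul,
        Matrix.mulVec_smul, hdx, hdy, smul_smul, smul_smul, mul_comm]
    · rw [Subgroup.index_comap_of_surjective θ.ker τ.rangeRestrict_surjective, hidx]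

end Final

end Literature.NumberTheory.GaloisRepresentations
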